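import Literature.Geometry.Lorentzian.KillingAlgebraAsymptoticallyFlat
import Literature.Geometry.Lorentzian.KillingFlowIsometry
import Literature.Geometry.Lorentzian.IsometricImmersionOneJetRigidity
import Literature.Geometry.Lorentzian.PointNullCone
import Literature.Geometry.Lorentzian.KillingFieldCurvatureIdentities
import Literature.Geometry.Manifold.FlowBoxFlow
import Literature.Analysis.ODE.ParametricLinear
import Mathlib.LinearAlgebra.QuadraticForm.Basic
import Mathlib.Analysis.SpecialFunctions.Trigonometric.Deriv
import Mathlib.Analysis.SpecialFunctions.Exponential
import HarnessLib

/-!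
# Commuting complete Killing fields: the flows commute and linear combinations are complete
# (proofs file of `KillingAlgebraAsymptoticallyFlat`)

Companion (proofs-only) file of `Literature.Geometry.Lorentzian.KillingAlgebraAsymptoticallyFlat`,
which vendors Beig–Chruściel's theorem (Commun. Math. Phys. 188 (1997), Thm. 1.2, as used by
Chruściel–Costa–Heusler 2012, §3.2.1) as the named fact
`BeigChrusciel1997_axisymmetricCombination`: for the stationary Killing field `T` and a complete
second Killing field `K` with `[T, K] = 0`, some combination `a T + b K` (`b ≠ 0`) is complete, has
`2π`-periodic orbits and a non-empty axis.  In the printed proof (arXiv:gr-qc/9610034, p. 8,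
case (ii)) the periodic element is found as `X₂ + αX₁` using "It follows [from `[X₁, X₂] = 0`]
that `φ_t[X₂ + αX₁] = φ_t[X₂] ∘ φ_t[αX₁]`": the flows of commuting complete fields commute and
compose to the flow of the sum.  This file proves that step in general (Lee, *Introduction to
Smooth Manifolds*, 2nd ed. (2012), Thm. 9.42 "for smooth vector fields `V` and `W` the
following are equivalent: (a) `V` and `W` commute; (b) `W` is invariant under the flow of `V` …",
i.e. `d(θ_t)_p (W_p) = W_{θ_t(p)}`, and Thm. 9.44 "smooth vector fields commute if and only if
their flows commute"; the composite `t ↦ θ_{at} ∘ ψ_{bt}` is then the flow of `a V + b W`, which is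
the identity Beig–Chruściel invoke), for `C^∞` fields on a Hausdorff manifold modelled on a
complete normed space `E` (`𝓘(ℝ, E)`, e.g. `𝓡 4`), and deduces the **completeness conjunct** of
the named fact for every combination `a T + b K`, whence the reduction
`BeigChrusciel1997_axisymmetricCombination.of_periodic_axis` of the fact to "some `a T + b K`,
`b ≠ 0`, has all orbits periodic (any non-zero period) and a zero" — the contents of
Beig–Chruściel's Props. 2.3 and 2.4.

The route avoids Lie derivatives (absent from Mathlib): at a point where `V ≠ 0` the flow-box
theorem of the tree (`Literature.Geometry.Manifold.exists_flowBox_flow_eq`, Lee Thm. 9.22) makes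
`V` constant and its flow a translation in a chart `ψ`; naturality of the Lie bracket under `ψ⁻¹`
(Mathlib `VectorField.mpullback_mlieBracket`) turns `[V, W] = 0` into `DŴ · v = 0` for the chart
representative `Ŵ` of `W`, i.e. `Ŵ` is invariant under the translation, which is `dθ_t W = W ∘ θ_t`
for small `t`; the group law spreads this along regular orbits, zeros of `V` are treated by
`θ_t = id` (interior) and density (boundary), and uniqueness of integral curves gives the
commutation of the flows and the integral curves `t ↦ θ_{at}(ψ_{bt}(x))` of `a V + b W`.

A second section formalises Beig–Chruściel's Thm. 1.1, point 3 ("If `a = 0`, then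
`φ₁[X](p) = p` for all `p`", proved from the rigidity of isometries, "[SCC]") in the tree's
vocabulary: a flow map of a complete Killing field with a fixed point at which its differential is
the identity is the identity (O'Neill 1983, Prop. 3.62, `IsIsometricImmersion.eq_id_of_oneJet_eq_id`,
with `IsKillingField.val_mfderiv_flow`), so that all orbits are periodic; whence the further
reduction `BeigChrusciel1997_axisymmetricCombination.of_isotropy_axis` of the named fact to "some
`a T + b K`, `b ≠ 0`, has an axis point at which its linear isotropy action is periodic".

A third section identifies the linear isotropy action at a zero `x₀` of a `C^∞` field `Y`:
`dθ_t|_{x₀} = exp(t ∇Y(x₀))` (the variational equation at a fixed point, from the symmetry lemma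
`x_{st} = x_{ts}` of O'Neill 1983, Ch. 4, Prop. 44 and uniqueness for linear equations), giving the
algebraic form `BeigChrusciel1997_axisymmetricCombination.of_exp_axis` of the reduction:
"some `a T + b K`, `b ≠ 0`, has a zero `x₀` with `exp(p ∇Y(x₀)) = 1` for some `p ≠ 0`".

## References

* R. Beig, P. T. Chruściel, Commun. Math. Phys. 188 (1997) 585–597, arXiv:gr-qc/9610034, proof of
  Thm. 1.2, case (ii) (key `BeigChrusciel1997`).
* J. M. Lee, *Introduction to Smooth Manifolds*, 2nd ed., GTM 218, Springer 2012, Thm. 9.22,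
  Thm. 9.42, Thm. 9.44 (key `LeeSmoothManifolds2013`).
* B. O'Neill, *Semi-Riemannian geometry*, Academic Press 1983, Ch. 3, Prop. 3.18 and Prop. 3.62;
  Ch. 4, Prop. 4.44; Ch. 9, Prop. 9.23 (key `ONeillSemiRiemannian1983`).
-/

noncomputable section

open Bundle Set Function Filter VectorField
open scoped Manifold ContDiff Topology

namespace Literature.Geometry.Lorentzian

section CommutingFlows

variable {E : Type*} [NormedAddCommGroup E] [NormedSpace ℝ E] [CompleteSpace E]
  {M : Type*} [TopologicalSpace M] [ChartedSpace E M] [IsManifold 𝓘(ℝ, E) ∞ M] [T2Space M]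
  {V W : Π x : M, TangentSpace 𝓘(ℝ, E) x} {θ : ℝ × M → M}

/-! ### In a flow box of `V`, a field commuting with `V` is invariant under the flow -/

/-- **Local invariance at a regular point** (Lee 2012, Thm. 9.42, direction `[V, W] = 0 ⇒ W` is
invariant under the flow of `V`, near a point where `V ≠ 0`): if `V`, `W` are `C^∞` fields with
`[V, W] = 0` and `θ` is a flow of `V` (`θ(0, ·) = id`, `t ↦ θ(t, p)` integral curves), then for
every `p` with `V p ≠ 0` and all small `t`, `dθ_t (W p) = W (θ_t p)`.  Proof: in a flow box `ψ` of
`V` about `p` (`Literature.Geometry.Manifold.exists_flowBox_flow_eq`) the field `V` is a constant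
`v` and `θ_t = ψ⁻¹ (ψ · + t v)`; by naturality of the bracket (`mpullback_mlieBracket`) the chart
representative `Ŵ = (ψ⁻¹)^* W` satisfies `DŴ · v = [v, Ŵ] = 0`, hence is constant along the
segment `ψ p + s v`, which is the claim read in the chart. [cite: LeeSmoothManifolds2013, Thm. 9.42] -/
theorem eventually_mfderiv_flow_apply_eq_of_ne_zero
    (hV : ContMDiff 𝓘(ℝ, E) 𝓘(ℝ, E).tangent ∞ (fun x ↦ (⟨x, V x⟩ : TangentBundle 𝓘(ℝ, E) M)))
    (hW : ContMDiff 𝓘(ℝ, E) 𝓘(ℝ, E).tangent ∞ (fun x ↦ (⟨x, W x⟩ : TangentBundle 𝓘(ℝ, E) M)))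
    (hVW : ∀ x, mlieBracket 𝓘(ℝ, E) V W x = 0)
    (hθV : ∀ p, IsMIntegralCurve (fun t ↦ θ (t, p)) V) (hθ0 : ∀ p, θ (0, p) = p)
    {p : M} (hp : V p ≠ 0) :
    ∀ᶠ t in 𝓝 (0 : ℝ),
      mfderiv 𝓘(ℝ, E) 𝓘(ℝ, E) (fun q ↦ θ (t, q)) p (W p) = W (θ (t, p)) := by
  obtain ⟨ψ, hψ, hpψ, hψV, hψv, ε, hε, N, hNo, hpN, hNψ, hbox⟩ :=
    Literature.Geometry.Manifold.exists_flowBox_flow_eq hV hθV hθ0 hp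
  set v : E := (show E from V p) with hv_def
  -- smoothness of `ψ`, `ψ⁻¹` and the mutual inverse differentials
  have hψt : ∀ q ∈ ψ.target, ContMDiffAt 𝓘(ℝ, E) 𝓘(ℝ, E) ∞ ψ.symm q := fun q hq ↦
    (contMDiffOn_symm_of_mem_maximalAtlas hψ).contMDiffAt (ψ.open_target.mem_nhds hq)
  have hψd : ψ.MDifferentiable 𝓘(ℝ, E) 𝓘(ℝ, E) :=
    ⟨(contMDiffOn_of_mem_maximalAtlas hψ).mdifferentiableOn (by simp),
      (contMDiffOn_symm_of_mem_maximalAtlas hψ).mdifferentiableOn (by simp)⟩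
  have hinv : ∀ x ∈ ψ.source,
      (mfderiv 𝓘(ℝ, E) 𝓘(ℝ, E) ψ.symm (ψ x)).inverse = mfderiv 𝓘(ℝ, E) 𝓘(ℝ, E) ψ x := by
    intro x hx
    refine ContinuousLinearMap.inverse_eq (hψd.symm_comp_deriv hx) ?_
    have h := hψd.comp_symm_deriv (ψ.map_source hx)
    rwa [ψ.left_inv hx] at h
  have hInv : ∀ q ∈ ψ.target, (mfderiv 𝓘(ℝ, E) 𝓘(ℝ, E) ψ.symm q).IsInvertible := by
    intro q hq
    refine ContinuousLinearMap.IsInvertible.of_inverse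
      (g := mfderiv 𝓘(ℝ, E) 𝓘(ℝ, E) ψ (ψ.symm q)) ?_ (hψd.comp_symm_deriv hq)
    have h := hψd.symm_comp_deriv (ψ.map_target hq)
    rwa [ψ.right_inv hq] at h
  -- the chart representatives: `V̂ ≡ v`, `Ŵ = (ψ⁻¹)^* W`
  have hVhat : ∀ q ∈ ψ.target, mpullback 𝓘(ℝ, E) 𝓘(ℝ, E) ψ.symm V q = v := by
    intro q hq
    have hx : ψ.symm q ∈ ψ.source := ψ.map_target hq
    have h1 := hinv (ψ.symm q) hx
    rw [ψ.right_inv hq] at h1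
    rw [mpullback_apply, h1]
    exact hψV (ψ.symm q) hx
  set What : E → E := fun q ↦ mpullback 𝓘(ℝ, E) 𝓘(ℝ, E) ψ.symm W q with hWhat_def
  have hWhat : ∀ x ∈ ψ.source, What (ψ x) = mfderiv 𝓘(ℝ, E) 𝓘(ℝ, E) ψ x (W x) := by
    intro x hx
    simp only [hWhat_def, mpullback_apply]
    rw [hinv x hx, ψ.left_inv hx]
  have hWhat_smooth : ∀ q ∈ ψ.target, ContDiffAt ℝ 1 What q := by
    intro q hq
    have h := ContMDiffAt.mpullback_vectorField_preimage (I := 𝓘(ℝ, E)) (I' := 𝓘(ℝ, E))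
      (m := 1) (n := ∞) ((hW (ψ.symm q)).of_le (by exact_mod_cast le_top)) (hψt q hq) (hInv q hq)
      (WithTop.coe_le_coe.2 le_top)
    exact contMDiffAt_vectorSpace_iff_contDiffAt.1 h
  -- `[V, W] = 0` read in the box: `DŴ · v = 0` on the target
  haveI : IsManifold 𝓘(ℝ, E) (minSmoothness ℝ 2) M := by
    rw [minSmoothness_of_isRCLikeNormedField]
    infer_instance
  have hbr : ∀ q ∈ ψ.target, fderiv ℝ What q v = 0 := by
    intro q hq
    have key := mpullback_mlieBracket (I := 𝓘(ℝ, E)) (I' := 𝓘(ℝ, E)) (f := ψ.symm) (V := V)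
      (W := W) (x₀ := q) ((hV _).mdifferentiableAt (by simp)) ((hW _).mdifferentiableAt (by simp))
      (hψt q hq) (by
        rw [minSmoothness_of_isRCLikeNormedField]
        exact (ENat.LEInfty.out : (2 : ℕ∞ω) ≤ ∞))
    rw [mpullback_apply, hVW, map_zero, ← mlieBracketWithin_univ,
      mlieBracketWithin_eq_lieBracketWithin, lieBracketWithin_univ] at key
    have hV' : (fun q ↦ mpullback 𝓘(ℝ, E) 𝓘(ℝ, E) ψ.symm V q) =ᶠ[𝓝 q] fun _ ↦ v := by
      filter_upwards [ψ.open_target.mem_nhds hq] with q' hq' using hVhat q' hq'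
    rw [hV'.lieBracket_vectorField_eq EventuallyEq.rfl] at key
    simp only [lieBracket, fderiv_fun_const, Pi.zero_apply, zero_apply, sub_zero] at key
    exact key.symm
  -- translation invariance of `Ŵ` along the segment `ψ p + s v`, `|s| < ε`
  have hseg : ∀ s ∈ Ioo (-ε) ε, ψ p + s • v ∈ ψ.target := fun s hs ↦ (hbox p hpN s hs).1
  have hderiv : ∀ s ∈ Ioo (-ε) ε, HasDerivAt (fun s : ℝ ↦ What (ψ p + s • v)) (0 : E) s := by
    intro s hs
    have h1 : HasDerivAt (fun s : ℝ ↦ ψ p + s • v) v s := by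
      simpa using ((hasDerivAt_id s).smul_const v).const_add (ψ p)
    have h2 : HasFDerivAt What (fderiv ℝ What (ψ p + s • v)) (ψ p + s • v) :=
      ((hWhat_smooth _ (hseg s hs)).differentiableAt one_ne_zero).hasFDerivAt
    have h3 := h2.comp_hasDerivAt s h1
    rwa [hbr _ (hseg s hs)] at h3
  have hconst : ∀ s ∈ Ioo (-ε) ε, What (ψ p + s • v) = What (ψ p) := by
    intro s hs
    have h0 : (0 : ℝ) ∈ Ioo (-ε) ε := ⟨by linarith, hε⟩
    have key := (convex_Ioo (-ε) ε).is_const_of_fderivWithin_eq_zero (𝕜 := ℝ)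
      (f := fun s : ℝ ↦ What (ψ p + s • v))
      (fun s hs ↦ (hderiv s hs).differentiableAt.differentiableWithinAt)
      (fun s hs ↦ by
        rw [fderivWithin_of_isOpen isOpen_Ioo hs, (hderiv s hs).hasFDerivAt.fderiv]
        ext
        simp) hs h0
    simpa using key
  -- conclusion, for `|t| < ε`
  filter_upwards [Ioo_mem_nhds (neg_lt_zero.2 hε) hε] with t ht
  obtain ⟨hq, -, hθeq, -⟩ := hbox p hpN t ht
  have hev : (fun q ↦ θ (t, q)) =ᶠ[𝓝 p] fun q ↦ ψ.symm (ψ q + t • v) := by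
    filter_upwards [hNo.mem_nhds hpN] with x hx using (hbox x hx t ht).2.2.1
  rw [hev.mfderiv_eq]
  have h1 : HasMFDerivAt 𝓘(ℝ, E) 𝓘(ℝ, E) ψ p (mfderiv 𝓘(ℝ, E) 𝓘(ℝ, E) ψ p) :=
    (hψd.mdifferentiableAt hpψ).hasMFDerivAt
  have h2 : HasMFDerivAt 𝓘(ℝ, E) 𝓘(ℝ, E) (fun q : E ↦ q + t • v) (ψ p)
      (ContinuousLinearMap.id ℝ (TangentSpace 𝓘(ℝ, E) (ψ p))) :=
    hasMFDerivAt_iff_hasFDerivAt.2 ((hasFDerivAt_id _).add_const _)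
  have h3 : HasMFDerivAt 𝓘(ℝ, E) 𝓘(ℝ, E) ψ.symm (ψ p + t • v)
      (mfderiv 𝓘(ℝ, E) 𝓘(ℝ, E) ψ.symm (ψ p + t • v)) :=
    (hψd.mdifferentiableAt_symm hq).hasMFDerivAt
  have hcomp : HasMFDerivAt 𝓘(ℝ, E) 𝓘(ℝ, E) (fun q ↦ ψ.symm (ψ q + t • v)) p
      ((mfderiv 𝓘(ℝ, E) 𝓘(ℝ, E) ψ.symm (ψ p + t • v)).comp
        ((ContinuousLinearMap.id ℝ (TangentSpace 𝓘(ℝ, E) (ψ p))).comp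
          (mfderiv 𝓘(ℝ, E) 𝓘(ℝ, E) ψ p))) :=
    h3.comp p (h2.comp p h1)
  rw [hcomp.mfderiv]
  change mfderiv 𝓘(ℝ, E) 𝓘(ℝ, E) ψ.symm (ψ p + t • v) (mfderiv 𝓘(ℝ, E) 𝓘(ℝ, E) ψ p (W p)) =
    W (θ (t, p))
  rw [← hWhat p hpψ, ← hconst t ht, hθeq]
  simp only [hWhat_def, mpullback_apply]
  have h := ContinuousLinearMap.ext_iff.1 (hInv _ hq).self_comp_inverse
    (W (ψ.symm (ψ p + t • v)))
  simpa using h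


/-! ### Invariance along a regular orbit, for all times -/

/-- **`W` is invariant under the flow of `V` along every regular orbit** (Lee 2012, Thm. 9.42):
under the hypotheses of `eventually_mfderiv_flow_apply_eq_of_ne_zero` and for a `C²` flow `θ`
with the group law, `dθ_t (W p) = W (θ_t p)` for *all* `t` when `V p ≠ 0`.  The set of good
times is closed (both sides are continuous curves in `TM`, which is Hausdorff) and open: near a
good time `t₀`, `θ_t = θ_{t - t₀} ∘ θ_{t₀}` and the local statement applies at `θ_{t₀} p`, where
`V ≠ 0` (a vector field has no zero on a non-trivial orbit). [cite: LeeSmoothManifolds2013, Thm. 9.42] -/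
theorem mfderiv_flow_apply_eq_of_ne_zero
    (hV : ContMDiff 𝓘(ℝ, E) 𝓘(ℝ, E).tangent ∞ (fun x ↦ (⟨x, V x⟩ : TangentBundle 𝓘(ℝ, E) M)))
    (hW : ContMDiff 𝓘(ℝ, E) 𝓘(ℝ, E).tangent ∞ (fun x ↦ (⟨x, W x⟩ : TangentBundle 𝓘(ℝ, E) M)))
    (hVW : ∀ x, mlieBracket 𝓘(ℝ, E) V W x = 0)
    (hθ : ContMDiff (𝓘(ℝ, ℝ).prod 𝓘(ℝ, E)) 𝓘(ℝ, E) 2 θ)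
    (hθV : ∀ p, IsMIntegralCurve (fun t ↦ θ (t, p)) V) (hθ0 : ∀ p, θ (0, p) = p)
    (hθadd : ∀ t s p, θ (t, θ (s, p)) = θ (t + s, p)) {p : M} (hp : V p ≠ 0) (t : ℝ) :
    mfderiv 𝓘(ℝ, E) 𝓘(ℝ, E) (fun q ↦ θ (t, q)) p (W p) = W (θ (t, p)) := by
  have hV1 : ContMDiff 𝓘(ℝ, E) 𝓘(ℝ, E).tangent 1
      (fun x ↦ (⟨x, V x⟩ : TangentBundle 𝓘(ℝ, E) M)) := hV.of_le (by exact_mod_cast le_top)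
  set S : Set ℝ :=
    {t | mfderiv 𝓘(ℝ, E) 𝓘(ℝ, E) (fun q ↦ θ (t, q)) p (W p) = W (θ (t, p))} with hS
  suffices h : S = univ by
    have ht : t ∈ S := h ▸ mem_univ t
    exact ht
  haveI : T2Space (TangentBundle 𝓘(ℝ, E) M) := t2Space_totalSpace
  refine IsClopen.eq_univ ⟨?_, ?_⟩ ⟨0, ?_⟩
  · -- closed: equaliser of two continuous curves in `TM`
    have hF : Continuous fun t : ℝ ↦
        (TotalSpace.mk' E (θ (t, p)) (mfderiv 𝓘(ℝ, E) 𝓘(ℝ, E) (fun q ↦ θ (t, q)) p (W p)) :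
          TangentBundle 𝓘(ℝ, E) M) :=
      PseudoRiemannianMetric.continuous_lift_mfderiv_flow hθ p (W p)
    have hG : Continuous fun t : ℝ ↦
        (TotalSpace.mk' E (θ (t, p)) (W (θ (t, p))) : TangentBundle 𝓘(ℝ, E) M) :=
      hW.continuous.comp (hθ.continuous.comp (continuous_id.prodMk continuous_const))
    have hcl := isClosed_eq hF hG
    convert hcl using 1
    ext t
    simp only [hS, mem_setOf_eq, TotalSpace.mk_inj]
  · -- open: propagate from a good time `t₀` by the local statement at `θ (t₀, p)`
    rw [isOpen_iff_mem_nhds]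
    intro t₀ ht₀
    have hz : V (θ (t₀, p)) ≠ 0 := by
      -- a vector field has no zero on a non-trivial orbit
      intro hz
      have hconst : ∀ s, θ (s, θ (t₀, p)) = θ (t₀, p) := fun s ↦
        (eq_flow_of_isMIntegralCurve hV1 hθV hθ0 (isMIntegralCurve_const hz) s).symm
      have hp0 : θ (t₀, p) = p := by
        have h := hconst (-t₀)
        rw [hθadd, neg_add_cancel, hθ0] at h
        exact h.symm
      exact hp (hp0 ▸ hz)
    have hA := eventually_mfderiv_flow_apply_eq_of_ne_zero hV hW hVW hθV hθ0 hz
    have hT : Tendsto (fun t : ℝ ↦ t - t₀) (𝓝 t₀) (𝓝 0) := by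
      have h : Tendsto (fun t : ℝ ↦ t - t₀) (𝓝 t₀) (𝓝 (t₀ - t₀)) :=
        tendsto_id.sub tendsto_const_nhds
      rwa [sub_self] at h
    filter_upwards [hT.eventually hA] with t ht
    have ht₀' : mfderiv 𝓘(ℝ, E) 𝓘(ℝ, E) (fun q ↦ θ (t₀, q)) p (W p) = W (θ (t₀, p)) := ht₀
    show mfderiv 𝓘(ℝ, E) 𝓘(ℝ, E) (fun q ↦ θ (t, q)) p (W p) = W (θ (t, p))
    have hfun : (fun q ↦ θ (t, q)) = (fun q ↦ θ (t - t₀, q)) ∘ (fun q ↦ θ (t₀, q)) := by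
      funext q
      simp [hθadd]
    have hd1 := PseudoRiemannianMetric.mdifferentiableAt_flow hθ (t - t₀) (θ (t₀, p))
    have hd2 := PseudoRiemannianMetric.mdifferentiableAt_flow hθ t₀ p
    rw [hfun, mfderiv_comp p hd1 hd2]
    change mfderiv 𝓘(ℝ, E) 𝓘(ℝ, E) (fun q ↦ θ (t - t₀, q)) (θ (t₀, p))
      (mfderiv 𝓘(ℝ, E) 𝓘(ℝ, E) (fun q ↦ θ (t₀, q)) p (W p)) = W (θ (t, p))
    rw [ht₀', ht, hθadd, sub_add_cancel]
  · -- `0 ∈ S`: `θ_0 = id`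
    show mfderiv 𝓘(ℝ, E) 𝓘(ℝ, E) (fun q ↦ θ (0, q)) p (W p) = W (θ (0, p))
    have hid : (fun q ↦ θ (0, q)) = id := funext hθ0
    rw [hid, mfderiv_id]
    change W p = W (θ (0, p))
    rw [hθ0]

/-! ### Invariance everywhere -/

/-- **`[V, W] = 0` implies that `W` is invariant under the flow of `V`** (Lee 2012, Thm. 9.42, for
`C^∞` fields on a Hausdorff manifold modelled on a complete normed space and a `C²` flow `θ` of `V`
with the group law): `dθ_t (W p) = W (θ_t p)` for all `t`, `p`.  At regular points of `V` this is
`mfderiv_flow_apply_eq_of_ne_zero`; on the interior of the zero set of `V` the flow is the identity;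
both sides are continuous in `p` (into the Hausdorff space `TM`) and these two sets are together
dense, whence the identity everywhere. [cite: LeeSmoothManifolds2013, Thm. 9.42] -/
theorem mfderiv_flow_apply_eq
    (hV : ContMDiff 𝓘(ℝ, E) 𝓘(ℝ, E).tangent ∞ (fun x ↦ (⟨x, V x⟩ : TangentBundle 𝓘(ℝ, E) M)))
    (hW : ContMDiff 𝓘(ℝ, E) 𝓘(ℝ, E).tangent ∞ (fun x ↦ (⟨x, W x⟩ : TangentBundle 𝓘(ℝ, E) M)))
    (hVW : ∀ x, mlieBracket 𝓘(ℝ, E) V W x = 0)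
    (hθ : ContMDiff (𝓘(ℝ, ℝ).prod 𝓘(ℝ, E)) 𝓘(ℝ, E) 2 θ)
    (hθV : ∀ p, IsMIntegralCurve (fun t ↦ θ (t, p)) V) (hθ0 : ∀ p, θ (0, p) = p)
    (hθadd : ∀ t s p, θ (t, θ (s, p)) = θ (t + s, p)) (t : ℝ) (p : M) :
    mfderiv 𝓘(ℝ, E) 𝓘(ℝ, E) (fun q ↦ θ (t, q)) p (W p) = W (θ (t, p)) := by
  haveI : T2Space (TangentBundle 𝓘(ℝ, E) M) := t2Space_totalSpace
  have hV1 : ContMDiff 𝓘(ℝ, E) 𝓘(ℝ, E).tangent 1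
      (fun x ↦ (⟨x, V x⟩ : TangentBundle 𝓘(ℝ, E) M)) := hV.of_le (by exact_mod_cast le_top)
  -- both sides as continuous maps `M → TM`
  set F : M → TangentBundle 𝓘(ℝ, E) M := fun p ↦
    TotalSpace.mk' E (θ (t, p)) (mfderiv 𝓘(ℝ, E) 𝓘(ℝ, E) (fun q ↦ θ (t, q)) p (W p)) with hF_def
  set G : M → TangentBundle 𝓘(ℝ, E) M := fun p ↦
    TotalSpace.mk' E (θ (t, p)) (W (θ (t, p))) with hG_def
  have hθt : ContMDiff 𝓘(ℝ, E) 𝓘(ℝ, E) 2 (fun q ↦ θ (t, q)) :=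
    hθ.comp (contMDiff_const.prodMk contMDiff_id)
  have hF : Continuous F :=
    (hθt.continuous_tangentMap (by exact_mod_cast one_le_two)).comp hW.continuous
  have hG : Continuous G :=
    hW.continuous.comp (hθ.continuous.comp (continuous_const.prodMk continuous_id))
  have hcl : IsClosed {p | F p = G p} := isClosed_eq hF hG
  -- the identity holds at regular points and on the interior of the zero set
  have hgood : ∀ p, (V p ≠ 0 ∨ p ∈ interior {x | V x = 0}) → F p = G p := by
    rintro p (hp | hp)
    · exact congrArg (TotalSpace.mk' E (θ (t, p)))
        (mfderiv_flow_apply_eq_of_ne_zero hV hW hVW hθ hθV hθ0 hθadd hp t)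
    · have hzero : ∀ᶠ q in 𝓝 p, V q = 0 := mem_interior_iff_mem_nhds.1 hp
      have hconst : ∀ q, V q = 0 → ∀ s, θ (s, q) = q := fun q hq s ↦
        (eq_flow_of_isMIntegralCurve hV1 hθV hθ0 (isMIntegralCurve_const hq) s).symm
      have hev : (fun q ↦ θ (t, q)) =ᶠ[𝓝 p] id := hzero.mono fun q hq ↦ hconst q hq t
      have hpt : θ (t, p) = p := hconst p hzero.self_of_nhds t
      show TotalSpace.mk' E (θ (t, p)) (mfderiv 𝓘(ℝ, E) 𝓘(ℝ, E) (fun q ↦ θ (t, q)) p (W p)) =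
        TotalSpace.mk' E (θ (t, p)) (W (θ (t, p)))
      rw [hev.mfderiv_eq, mfderiv_id, hpt]
      rfl
  -- these points are dense
  have hdense : Dense {p : M | V p ≠ 0 ∨ p ∈ interior {x | V x = 0}} := by
    rw [dense_iff_inter_open]
    rintro U hU ⟨x, hx⟩
    by_cases h : ∃ y ∈ U, V y ≠ 0
    · obtain ⟨y, hy, hVy⟩ := h
      exact ⟨y, hy, Or.inl hVy⟩
    · push Not at h
      exact ⟨x, hx, Or.inr ((hU.subset_interior_iff.2 fun y hy ↦ h y hy) hx)⟩
  -- a closed set containing a dense set is everything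
  have hall : Dense {p | F p = G p} := hdense.mono fun q hq ↦ hgood q hq
  have hp : F p = G p := by
    have h := hall.closure_eq
    rw [hcl.closure_eq] at h
    exact (h.symm ▸ mem_univ p : p ∈ {p | F p = G p})
  exact TotalSpace.mk_inj.1 hp

/-! ### Commuting flows -/

/-- **The flows of commuting complete fields commute** (Lee 2012, Thm. 9.44): with `θ` a `C²` flow
of `V` (group law) and `φ` any flow of `W` (`φ(0, ·) = id`, `s ↦ φ(s, x)` integral curves),
`θ_t (φ_s x) = φ_s (θ_t x)`.  Indeed `s ↦ θ_t (φ_s x)` is an integral curve of `W` (chain rule and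
`dθ_t W = W ∘ θ_t`, `mfderiv_flow_apply_eq`) through `θ_t x`, hence is `s ↦ φ_s (θ_t x)` by
uniqueness of integral curves.  This is the identity "`φ_t[X₂ + αX₁] = φ_t[X₂] ∘ φ_t[αX₁]`" step
of Beig–Chruściel's proof. [cite: LeeSmoothManifolds2013, Thm. 9.44] [cite: BeigChrusciel1997, proof of Thm. 1.2, case (ii)] -/
theorem flow_comm_of_mlieBracket_eq_zero
    (hV : ContMDiff 𝓘(ℝ, E) 𝓘(ℝ, E).tangent ∞ (fun x ↦ (⟨x, V x⟩ : TangentBundle 𝓘(ℝ, E) M)))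
    (hW : ContMDiff 𝓘(ℝ, E) 𝓘(ℝ, E).tangent ∞ (fun x ↦ (⟨x, W x⟩ : TangentBundle 𝓘(ℝ, E) M)))
    (hVW : ∀ x, mlieBracket 𝓘(ℝ, E) V W x = 0)
    (hθ : ContMDiff (𝓘(ℝ, ℝ).prod 𝓘(ℝ, E)) 𝓘(ℝ, E) 2 θ)
    (hθV : ∀ p, IsMIntegralCurve (fun t ↦ θ (t, p)) V) (hθ0 : ∀ p, θ (0, p) = p)
    (hθadd : ∀ t s p, θ (t, θ (s, p)) = θ (t + s, p)) {φ : ℝ × M → M}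
    (hφW : ∀ p, IsMIntegralCurve (fun s ↦ φ (s, p)) W) (hφ0 : ∀ p, φ (0, p) = p)
    (t s : ℝ) (x : M) : θ (t, φ (s, x)) = φ (s, θ (t, x)) := by
  have hW1 : ContMDiff 𝓘(ℝ, E) 𝓘(ℝ, E).tangent 1
      (fun x ↦ (⟨x, W x⟩ : TangentBundle 𝓘(ℝ, E) M)) := hW.of_le (by exact_mod_cast le_top)
  have hcurve : IsMIntegralCurve (fun s ↦ θ (t, φ (s, x))) W := by
    intro s
    have hd := PseudoRiemannianMetric.mdifferentiableAt_flow hθ t (φ (s, x))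
    have h := hd.hasMFDerivAt.comp s (hφW x s)
    have heq : (mfderiv 𝓘(ℝ, E) 𝓘(ℝ, E) (fun q ↦ θ (t, q)) (φ (s, x))).comp
        ((1 : ℝ →L[ℝ] ℝ).smulRight (W (φ (s, x)))) =
        (1 : ℝ →L[ℝ] ℝ).smulRight (W (θ (t, φ (s, x)))) := by
      apply ContinuousLinearMap.ext_ring
      simp only [ContinuousLinearMap.comp_apply, ContinuousLinearMap.smulRight_apply,
        one_apply_eq_self, one_smul]
      exact mfderiv_flow_apply_eq hV hW hVW hθ hθV hθ0 hθadd t (φ (s, x))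
    exact h.congr_mfderiv heq
  have h := eq_flow_of_isMIntegralCurve hW1 hφW hφ0 hcurve s
  simpa [hφ0] using h

/-! ### The flow of `a V + b W` -/

/-- **Integral curves of a linear combination of commuting fields** (the flow of `a V + b W` is
`t ↦ θ_{at} ∘ φ_{bt}`; Beig–Chruściel 1997, proof of Thm. 1.2 (ii): "It follows that
`φ_t[X₂ + αX₁] = φ_t[X₂] ∘ φ_t[αX₁]`"): `t ↦ θ_{at} (φ_{bt} x)` is an integral curve of
`a V + b W` — chain rule for the `C²` map `θ` along the curve `t ↦ (at, φ_{bt} x)`, the flow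
equations, and the invariance `dθ_τ W = W ∘ θ_τ` (`mfderiv_flow_apply_eq`, Lee 2012, Thm. 9.42).
[cite: BeigChrusciel1997, proof of Thm. 1.2, case (ii)] [cite: LeeSmoothManifolds2013, Thm. 9.42] -/
theorem isMIntegralCurve_flow_flow_of_mlieBracket_eq_zero
    (hV : ContMDiff 𝓘(ℝ, E) 𝓘(ℝ, E).tangent ∞ (fun x ↦ (⟨x, V x⟩ : TangentBundle 𝓘(ℝ, E) M)))
    (hW : ContMDiff 𝓘(ℝ, E) 𝓘(ℝ, E).tangent ∞ (fun x ↦ (⟨x, W x⟩ : TangentBundle 𝓘(ℝ, E) M)))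
    (hVW : ∀ x, mlieBracket 𝓘(ℝ, E) V W x = 0)
    (hθ : ContMDiff (𝓘(ℝ, ℝ).prod 𝓘(ℝ, E)) 𝓘(ℝ, E) 2 θ)
    (hθV : ∀ p, IsMIntegralCurve (fun t ↦ θ (t, p)) V) (hθ0 : ∀ p, θ (0, p) = p)
    (hθadd : ∀ t s p, θ (t, θ (s, p)) = θ (t + s, p)) {φ : ℝ × M → M}
    (hφW : ∀ p, IsMIntegralCurve (fun s ↦ φ (s, p)) W) (a b : ℝ) (x : M) :
    IsMIntegralCurve (fun t ↦ θ (t * a, φ (t * b, x))) (a • V + b • W) := by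
  intro t
  -- the curve `c t = (t a, φ_{t b} x)` in `ℝ × M` and its derivative
  have hc1 : HasMFDerivAt 𝓘(ℝ, ℝ) 𝓘(ℝ, ℝ) (fun t : ℝ ↦ t * a) t
      ((1 : ℝ →L[ℝ] ℝ).smulRight (a : ℝ)) := by
    rw [hasMFDerivAt_iff_hasFDerivAt]
    have h : HasDerivAt (fun t : ℝ ↦ t * a) a t := by
      simpa using (hasDerivAt_id t).mul_const a
    exact h.hasFDerivAt
  have hc2 : HasMFDerivAt 𝓘(ℝ, ℝ) 𝓘(ℝ, E) (fun t : ℝ ↦ φ (t * b, x)) t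
      ((1 : ℝ →L[ℝ] ℝ).smulRight ((b • W) (φ (t * b, x)))) :=
    (hφW x).comp_mul b t
  have hc := hc1.prodMk hc2
  -- `θ` is differentiable at `c t`
  have hθd : MDifferentiableAt (𝓘(ℝ, ℝ).prod 𝓘(ℝ, E)) 𝓘(ℝ, E) θ (t * a, φ (t * b, x)) :=
    (hθ _).mdifferentiableAt two_ne_zero
  have hcomp := hθd.hasMFDerivAt.comp t hc
  -- identify the derivative
  have key : (mfderiv (𝓘(ℝ, ℝ).prod 𝓘(ℝ, E)) 𝓘(ℝ, E) θ (t * a, φ (t * b, x))).comp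
      (((1 : ℝ →L[ℝ] ℝ).smulRight (a : ℝ)).prod
        ((1 : ℝ →L[ℝ] ℝ).smulRight ((b • W) (φ (t * b, x))))) =
      (1 : ℝ →L[ℝ] ℝ).smulRight ((a • V + b • W) (θ (t * a, φ (t * b, x)))) := by
    apply ContinuousLinearMap.ext_ring
    -- the `τ`-derivative is `V`, the `y`-derivative maps `W` to `W`
    have h1 : mfderiv 𝓘(ℝ, ℝ) 𝓘(ℝ, E) (fun τ : ℝ ↦ θ (τ, φ (t * b, x))) (t * a) a =
        a • V (θ (t * a, φ (t * b, x))) := by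
      rw [(hθV (φ (t * b, x)) (t * a)).mfderiv]
      rfl
    have h2 : mfderiv 𝓘(ℝ, E) 𝓘(ℝ, E) (fun y ↦ θ (t * a, y)) (φ (t * b, x))
        ((b • W) (φ (t * b, x))) = (b • W) (θ (t * a, φ (t * b, x))) := by
      simp only [Pi.smul_apply, map_smul]
      rw [mfderiv_flow_apply_eq hV hW hVW hθ hθV hθ0 hθadd]
    set L : ℝ →L[ℝ] ℝ × TangentSpace 𝓘(ℝ, E) (φ (t * b, x)) :=
      ((1 : ℝ →L[ℝ] ℝ).smulRight (a : ℝ)).prod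
        ((1 : ℝ →L[ℝ] ℝ).smulRight ((b • W) (φ (t * b, x)))) with hL
    have e1a : (L 1).1 = a := by simp [hL]
    have e1b : (L 1).2 = (b • W) (φ (t * b, x)) := by simp [hL]
    calc ((mfderiv (𝓘(ℝ, ℝ).prod 𝓘(ℝ, E)) 𝓘(ℝ, E) θ (t * a, φ (t * b, x))).comp L) 1
        = mfderiv (𝓘(ℝ, ℝ).prod 𝓘(ℝ, E)) 𝓘(ℝ, E) θ (t * a, φ (t * b, x)) (L 1) := rfl
      _ = mfderiv 𝓘(ℝ, ℝ) 𝓘(ℝ, E) (fun τ : ℝ ↦ θ (τ, φ (t * b, x))) (t * a) (L 1).1 +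
            mfderiv 𝓘(ℝ, E) 𝓘(ℝ, E) (fun y ↦ θ (t * a, y)) (φ (t * b, x)) (L 1).2 :=
          mfderiv_prod_eq_add_apply hθd
      _ = mfderiv 𝓘(ℝ, ℝ) 𝓘(ℝ, E) (fun τ : ℝ ↦ θ (τ, φ (t * b, x))) (t * a) a +
            mfderiv 𝓘(ℝ, E) 𝓘(ℝ, E) (fun y ↦ θ (t * a, y)) (φ (t * b, x))
              ((b • W) (φ (t * b, x))) := by
          rw [e1a, e1b]
      _ = a • V (θ (t * a, φ (t * b, x))) + (b • W) (θ (t * a, φ (t * b, x))) := by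
          rw [h1, h2]
      _ = ((1 : ℝ →L[ℝ] ℝ).smulRight ((a • V + b • W) (θ (t * a, φ (t * b, x))))) 1 := by
          simp
  exact hcomp.congr_mfderiv key

/-- **Linear combinations of commuting complete `C^∞` fields are complete** (the completeness of
every element of `span{X₁, X₂}` used in Beig–Chruściel's proof of Thm. 1.2, case (ii), via
"`φ_t[X₂ + αX₁] = φ_t[X₂] ∘ φ_t[αX₁]`"; Lee 2012, Thms. 9.12, 9.42, 9.44): if `V`, `W` are complete
`C^∞` vector fields with `[V, W] = 0` on a Hausdorff manifold modelled on a complete normed space,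
then `a V + b W` is complete, with integral curves `t ↦ θ_{at} (φ_{bt} x)` for the global flows
`θ`, `φ` of `V`, `W` (`Literature.Geometry.Manifold.exists_contMDiff_globalFlow_of_complete`).
[cite: BeigChrusciel1997, proof of Thm. 1.2, case (ii)] [cite: LeeSmoothManifolds2013, Thm. 9.42 and Thm. 9.44] -/
theorem isCompleteVectorField_linearCombination_of_mlieBracket_eq_zero
    (hV : ContMDiff 𝓘(ℝ, E) 𝓘(ℝ, E).tangent ∞ (fun x ↦ (⟨x, V x⟩ : TangentBundle 𝓘(ℝ, E) M)))
    (hW : ContMDiff 𝓘(ℝ, E) 𝓘(ℝ, E).tangent ∞ (fun x ↦ (⟨x, W x⟩ : TangentBundle 𝓘(ℝ, E) M)))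
    (hVW : ∀ x, mlieBracket 𝓘(ℝ, E) V W x = 0)
    (hVc : IsCompleteVectorField V) (hWc : IsCompleteVectorField W) (a b : ℝ) :
    IsCompleteVectorField (a • V + b • W) := by
  obtain ⟨θ, hθ, hθ0, hθadd, hθV⟩ :=
    Literature.Geometry.Manifold.exists_contMDiff_globalFlow_of_complete (n := ⊤) hV
      (by exact_mod_cast le_top) fun x ↦ by
        obtain ⟨γ, hγ, h0⟩ := hVc x
        exact ⟨γ, h0, hγ⟩
  obtain ⟨φ, -, hφ0, -, hφW⟩ :=
    Literature.Geometry.Manifold.exists_contMDiff_globalFlow_of_complete (n := ⊤) hW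
      (by exact_mod_cast le_top) fun x ↦ by
        obtain ⟨γ, hγ, h0⟩ := hWc x
        exact ⟨γ, h0, hγ⟩
  have hθ2 : ContMDiff (𝓘(ℝ, ℝ).prod 𝓘(ℝ, E)) 𝓘(ℝ, E) 2 θ :=
    hθ.of_le (ENat.LEInfty.out : (2 : ℕ∞ω) ≤ ∞)
  intro x
  exact ⟨fun t ↦ θ (t * a, φ (t * b, x)),
    isMIntegralCurve_flow_flow_of_mlieBracket_eq_zero hV hW hVW hθ2 hθV hθ0 hθadd hφW a b x,
    by simp [hθ0, hφ0]⟩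

/-- **Sums of commuting complete `C^∞` fields are complete** (`a = b = 1` in
`isCompleteVectorField_linearCombination_of_mlieBracket_eq_zero`). [cite: LeeSmoothManifolds2013, Thm. 9.42 and Thm. 9.44] -/
theorem isCompleteVectorField_add_of_mlieBracket_eq_zero
    (hV : ContMDiff 𝓘(ℝ, E) 𝓘(ℝ, E).tangent ∞ (fun x ↦ (⟨x, V x⟩ : TangentBundle 𝓘(ℝ, E) M)))
    (hW : ContMDiff 𝓘(ℝ, E) 𝓘(ℝ, E).tangent ∞ (fun x ↦ (⟨x, W x⟩ : TangentBundle 𝓘(ℝ, E) M)))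
    (hVW : ∀ x, mlieBracket 𝓘(ℝ, E) V W x = 0)
    (hVc : IsCompleteVectorField V) (hWc : IsCompleteVectorField W) :
    IsCompleteVectorField (V + W) := by
  simpa using isCompleteVectorField_linearCombination_of_mlieBracket_eq_zero hV hW hVW hVc hWc 1 1

end CommutingFlows

/-! ### Application: the completeness conjunct of the Beig–Chruściel combination -/

namespace StationaryAFBlackHole

universe u

variable (𝓑 : StationaryAFBlackHole.{u}) [𝓑.metric.HasLeviCivita]

/-- **Every combination `a • T + b • K` of the stationary Killing field with a commuting complete
Killing field is complete** (the completeness conjunct of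
`BeigChrusciel1997_axisymmetricCombination`, for *all* `a`, `b`): `T = 𝓑.killing` is a complete
`C^∞` Killing field, and the flows of commuting complete fields compose to the flow of the
combination (`isCompleteVectorField_linearCombination_of_mlieBracket_eq_zero`).  Beig–Chruściel
1997, proof of Thm. 1.2, case (ii): "`φ_t[X₂ + αX₁] = φ_t[X₂] ∘ φ_t[αX₁]`". [cite: BeigChrusciel1997, proof of Thm. 1.2, case (ii)] -/
theorem isCompleteVectorField_killing_linearCombination
    {K : Π x : 𝓑.carrier, TangentSpace (𝓡 4) x} (hK : 𝓑.metric.IsKillingField K)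
    (hKc : IsCompleteVectorField K)
    (hcomm : ∀ x, VectorField.mlieBracket (𝓡 4) 𝓑.killing K x = 0) (a b : ℝ) :
    IsCompleteVectorField (a • 𝓑.killing + b • K) :=
  isCompleteVectorField_linearCombination_of_mlieBracket_eq_zero
    𝓑.isStationaryKilling.isKillingField.contMDiff hK.contMDiff hcomm
    𝓑.isStationaryKilling.isCompleteVectorField hKc a b

end StationaryAFBlackHole

/-- **Reduction of the Beig–Chruściel combination to "periodic with an axis".** Completeness of
`a • T + b • K` being automatic (`StationaryAFBlackHole.isCompleteVectorField_killing_linearCombination`)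
and the period being normalisable (`BeigChrusciel1997_axisymmetricCombination.of_period`), the
named fact follows from: for every `𝓑`, `K` as there, some `a • T + b • K` with `b ≠ 0` has all
its integral curves `p`-periodic for some `p ≠ 0` and vanishes somewhere — precisely the content of
Beig–Chruściel's Prop. 2.3 (periodicity, "`φ₁[X₂ + αX₁](p) = p`") and Prop. 2.4 (non-empty axis)
in case (ii) of the proof of Thm. 1.2. [cite: BeigChrusciel1997, proof of Thm. 1.2, case (ii), with Props. 2.3–2.4] -/
theorem BeigChrusciel1997_axisymmetricCombination.of_periodic_axis.{v}
    (h : ∀ (𝓑 : StationaryAFBlackHole.{v}) [𝓑.metric.HasLeviCivita],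
      𝓑.IsIPlusRegularNonDegenerate → 𝓑.metric.toPseudoRiemannianMetric.IsRicciFlat →
      ∀ K : Π x : 𝓑.carrier, TangentSpace (𝓡 4) x,
        𝓑.metric.IsKillingField K → IsCompleteVectorField K →
        (∀ x, VectorField.mlieBracket (𝓡 4) 𝓑.killing K x = 0) →
        (¬ ∃ c : ℝ, K = c • 𝓑.killing) →
        ∃ a b p : ℝ, b ≠ 0 ∧ p ≠ 0 ∧
          (∀ γ : ℝ → 𝓑.carrier, IsMIntegralCurve γ (a • 𝓑.killing + b • K) →
            Function.Periodic γ p) ∧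
          ∃ x, (a • 𝓑.killing + b • K) x = 0) :
    BeigChrusciel1997_axisymmetricCombination.{v} := by
  refine BeigChrusciel1997_axisymmetricCombination.of_period fun 𝓑 _ hreg hvac K hK hKc hcomm hrot ↦ ?_
  obtain ⟨a, b, p, hb, hp, hper, hx⟩ := h 𝓑 hreg hvac K hK hKc hcomm hrot
  exact ⟨a, b, p, hb, hp, 𝓑.isCompleteVectorField_killing_linearCombination hK hKc hcomm a b,
    hper, hx⟩

/-! ### Periodicity from the one-jet of a flow map (Beig–Chruściel 1997, Thm. 1.1 (3))

Beig–Chruściel obtain the periodicity of *all* orbits of the rotational combination from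
information at finitely many points only through rigidity of isometries: Thm. 1.1, point 3 — "If
`a = 0`, then `φ₁[X](p) = p` for all `p` for which `φ₁[X](p)` is defined" — is proved (end of the
proof of Prop. 2.3) by "`φ₁` is therefore an isometry which reduces to an identity on a spacelike
hypersurface, and point 3 follows from [SCC]".  In the tree the rigidity statement is O'Neill's
Prop. 3.62 (`IsIsometricImmersion.eq_id_of_oneJet_eq_id`, file `IsometricImmersionOneJetRigidity`):
an isometric immersion of a connected manifold with a fixed point at which its differential is the
identity is the identity.  Combined with "the flow maps of a Killing field are isometries"
(`IsKillingField.val_mfderiv_flow`, `KillingFlowIsometry`) this gives: **if some flow map `θ_p`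
of a complete Killing field `Y` has a fixed point with identity differential, then `θ_p = id` and
every orbit of `Y` is `p`-periodic** — in particular for an axis point `x₀` (`Y x₀ = 0`, so that
`θ_p x₀ = x₀` for all `p`) at which the linear isotropy action `p ↦ dθ_p|_{x₀}` is periodic. -/

section OneJetPeriodicity

variable {E : Type*} [NormedAddCommGroup E] [NormedSpace ℝ E] [FiniteDimensional ℝ E]
  {H : Type*} [TopologicalSpace H] {I : ModelWithCorners ℝ E H} [I.Boundaryless]
  {M : Type*} [TopologicalSpace M] [ChartedSpace H M] [IsManifold I ∞ M] [T2Space M]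

namespace PseudoRiemannianMetric

variable {g : PseudoRiemannianMetric I ∞ E (TangentSpace I : M → Type _)} [g.HasLeviCivita]
  {Y : Π x : M, TangentSpace I x} {θ : ℝ × M → M}

omit [T2Space M] in
/-- **The flow maps of a Killing field are isometric immersions** `θ_t^* g = g` (O'Neill 1983,
Ch. 9, Prop. 9.23: the flow of a Killing field consists of isometries; here for a `C^∞` flow `θ`
of the Killing field `Y` given as data, from `IsKillingField.val_mfderiv_flow`).
[cite: ONeillSemiRiemannian1983, Ch. 9, Prop. 9.23] -/
theorem IsKillingField.isIsometricImmersion_flow (hY : g.IsKillingField Y)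
    (hθ : ContMDiff (𝓘(ℝ, ℝ).prod I) I ∞ θ) (hθ0 : ∀ p, θ (0, p) = p)
    (hθY : ∀ p, IsMIntegralCurve (fun t ↦ θ (t, p)) Y) (t : ℝ) :
    IsIsometricImmersion g g (fun q ↦ θ (t, q)) := by
  refine ⟨hθ.comp (contMDiff_const.prodMk contMDiff_id), fun y ↦ ?_⟩
  ext v w
  rw [pullbackBilin_apply]
  exact hY.val_mfderiv_flow (hθ.of_le (ENat.LEInfty.out : (2 : ℕ∞ω) ≤ ∞)) hθ0 hθY t y v w

/-- **Beig–Chruściel 1997, Thm. 1.1 (3): a flow map of a Killing field with identity one-jet at a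
point is the identity.** Let `Y` be a Killing field of the `C^∞` metric `g` on a connected Hausdorff
manifold (boundaryless finite-dimensional model) with a `C^∞` flow `θ`. If `θ_p x₀ = x₀` and
`dθ_p|_{x₀} = id` for some `p`, `x₀`, then `θ_p x = x` for every `x`: `θ_p` is an isometric
immersion (`isIsometricImmersion_flow`), so O'Neill's Prop. 3.62 applies
(`IsIsometricImmersion.eq_id_of_oneJet_eq_id`). Printed: "`φ₁` is therefore an isometry which
reduces to an identity on a spacelike hypersurface, and point 3 follows from [SCC]" (proof of
Prop. 2.3). [cite: BeigChrusciel1997, Thm. 1.1 (3) and proof of Prop. 2.3 (3)] [cite: ONeillSemiRiemannian1983, Ch. 3, Prop. 3.62] -/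
theorem IsKillingField.flow_apply_eq_self_of_oneJet [ConnectedSpace M] (hY : g.IsKillingField Y)
    (hθ : ContMDiff (𝓘(ℝ, ℝ).prod I) I ∞ θ) (hθ0 : ∀ p, θ (0, p) = p)
    (hθY : ∀ p, IsMIntegralCurve (fun t ↦ θ (t, p)) Y) {p : ℝ} {x₀ : M} (hx₀ : θ (p, x₀) = x₀)
    (hd : ∀ w : TangentSpace I x₀, mfderiv I I (fun q ↦ θ (p, q)) x₀ w = w) (x : M) :
    θ (p, x) = x :=
  congrFun ((hY.isIsometricImmersion_flow hθ hθ0 hθY p).eq_id_of_oneJet_eq_id hx₀ hd) x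

/-- **All orbits are then periodic** (Beig–Chruściel 1997, proof of Thm. 1.2, case (ii): "By point 3
of Theorem 1.1 we obtain `φ₁[X₂ + αX₁](p) = p`, hence all orbits of `X₂ + αX₁` are periodic with
period `1`"): under the hypotheses of `flow_apply_eq_self_of_oneJet` and the group law for `θ`,
every integral curve `γ` of `Y` satisfies `γ (t + p) = γ t`. [cite: BeigChrusciel1997, proof of Thm. 1.2, case (ii)] -/
theorem IsKillingField.periodic_of_oneJet [ConnectedSpace M] (hY : g.IsKillingField Y)
    (hθ : ContMDiff (𝓘(ℝ, ℝ).prod I) I ∞ θ) (hθ0 : ∀ p, θ (0, p) = p)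
    (hθadd : ∀ t s q, θ (t, θ (s, q)) = θ (t + s, q))
    (hθY : ∀ p, IsMIntegralCurve (fun t ↦ θ (t, p)) Y) {p : ℝ} {x₀ : M} (hx₀ : θ (p, x₀) = x₀)
    (hd : ∀ w : TangentSpace I x₀, mfderiv I I (fun q ↦ θ (p, q)) x₀ w = w)
    {γ : ℝ → M} (hγ : IsMIntegralCurve γ Y) : Function.Periodic γ p := by
  have hY1 : CMDiff 1 (T% Y) := hY.contMDiff.of_le (by exact_mod_cast le_top)
  intro t
  rw [eq_flow_of_isMIntegralCurve hY1 hθY hθ0 hγ (t + p), eq_flow_of_isMIntegralCurve hY1 hθY hθ0 hγ t,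
    ← hθadd, hY.flow_apply_eq_self_of_oneJet hθ hθ0 hθY hx₀ hd]

omit [FiniteDimensional ℝ E] in
/-- **An axis point is fixed by every flow map**: if `Y x₀ = 0` then `θ_p x₀ = x₀` for all `p`
(the constant curve is the integral curve through `x₀`). [folklore] -/
theorem IsKillingField.flow_apply_eq_of_apply_eq_zero (hY : g.IsKillingField Y)
    (hθ0 : ∀ p, θ (0, p) = p) (hθY : ∀ p, IsMIntegralCurve (fun t ↦ θ (t, p)) Y) {x₀ : M}
    (hx₀ : Y x₀ = 0) (p : ℝ) : θ (p, x₀) = x₀ :=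
  (eq_flow_of_isMIntegralCurve (hY.contMDiff.of_le (by exact_mod_cast le_top)) hθY hθ0
    (isMIntegralCurve_const hx₀) p).symm

end PseudoRiemannianMetric

end OneJetPeriodicity

/-! ### Application: reduction of the fact to an axis point with periodic linear isotropy -/

/-- **Reduction of the Beig–Chruściel combination to "an axis point with periodic isotropy".**
`BeigChrusciel1997_axisymmetricCombination` follows from: for every `𝓑`, `K` as there, some
combination `Y = a • T + b • K` with `b ≠ 0` vanishes at a point `x₀` at which, for some `p ≠ 0`,
the flow map `θ_p` of `Y` (any `C^∞` flow of `Y` with `θ_0 = id`) has identity differential.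
Indeed `Y` is a complete Killing field (`StationaryAFBlackHole.isCompleteVectorField_killing_linearCombination`,
`IsKillingField.linearCombination`) with a `C^∞` global flow
(`Literature.Geometry.Manifold.exists_contMDiff_globalFlow_of_complete`), `θ_p x₀ = x₀` as
`Y x₀ = 0`, so all orbits are `p`-periodic (`IsKillingField.periodic_of_oneJet`, Beig–Chruściel's
Thm. 1.1 (3) via O'Neill's Prop. 3.62), and `of_periodic_axis` concludes. This isolates what
Beig–Chruściel's asymptotic analysis (Props. 2.1–2.4 with Thm. 1.1) provides: a rotational
combination, its axis, and the closing-up of its isotropy action.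
[cite: BeigChrusciel1997, Thm. 1.1 (3), Props. 2.3–2.4 and proof of Thm. 1.2, case (ii)] -/
theorem BeigChrusciel1997_axisymmetricCombination.of_isotropy_axis.{v}
    (h : ∀ (𝓑 : StationaryAFBlackHole.{v}) [𝓑.metric.HasLeviCivita],
      𝓑.IsIPlusRegularNonDegenerate → 𝓑.metric.toPseudoRiemannianMetric.IsRicciFlat →
      ∀ K : Π x : 𝓑.carrier, TangentSpace (𝓡 4) x,
        𝓑.metric.IsKillingField K → IsCompleteVectorField K →
        (∀ x, VectorField.mlieBracket (𝓡 4) 𝓑.killing K x = 0) →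
        (¬ ∃ c : ℝ, K = c • 𝓑.killing) →
        ∃ a b p : ℝ, b ≠ 0 ∧ p ≠ 0 ∧ ∃ x₀, (a • 𝓑.killing + b • K) x₀ = 0 ∧
          ∀ θ : ℝ × 𝓑.carrier → 𝓑.carrier, ContMDiff (𝓘(ℝ, ℝ).prod (𝓡 4)) (𝓡 4) ∞ θ →
            (∀ q, θ (0, q) = q) →
            (∀ q, IsMIntegralCurve (fun t ↦ θ (t, q)) (a • 𝓑.killing + b • K)) →
            ∀ w : TangentSpace (𝓡 4) x₀, mfderiv (𝓡 4) (𝓡 4) (fun q ↦ θ (p, q)) x₀ w = w) :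
    BeigChrusciel1997_axisymmetricCombination.{v} := by
  refine BeigChrusciel1997_axisymmetricCombination.of_periodic_axis
    fun 𝓑 _ hreg hvac K hK hKc hcomm hrot ↦ ?_
  obtain ⟨a, b, p, hb, hp, x₀, hx₀, hiso⟩ := h 𝓑 hreg hvac K hK hKc hcomm hrot
  -- the combination is a complete `C^∞` Killing field; take its global flow
  have hY : 𝓑.metric.IsKillingField (a • 𝓑.killing + b • K) :=
    𝓑.isStationaryKilling.isKillingField.linearCombination hK a b
  have hYc : IsCompleteVectorField (a • 𝓑.killing + b • K) :=
    𝓑.isCompleteVectorField_killing_linearCombination hK hKc hcomm a b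
  obtain ⟨θ, hθ, hθ0, hθadd, hθY⟩ :=
    Literature.Geometry.Manifold.exists_contMDiff_globalFlow_of_complete (n := ⊤) hY.contMDiff
      (by exact_mod_cast le_top) fun x ↦ by
        obtain ⟨γ, hγ, h0⟩ := hYc x
        exact ⟨γ, h0, hγ⟩
  have hfix : θ (p, x₀) = x₀ := hY.flow_apply_eq_of_apply_eq_zero hθ0 hθY hx₀ p
  exact ⟨a, b, p, hb, hp,
    fun γ hγ ↦ hY.periodic_of_oneJet hθ hθ0 hθadd hθY hfix (hiso θ hθ hθ0 hθY) hγ, x₀, hx₀⟩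

/-! ### The linear isotropy action at a zero of the field is `t ↦ exp(t ∇Y(x₀))`

At an axis point `x₀` (`Y x₀ = 0`) the flow maps fix `x₀` and act on `T_{x₀}M` by their
differentials `L_t = dθ_t|_{x₀}`; classically `L_t = exp(t A)` with `A = ∇Y(x₀)` (the covariant
differential at a zero, where it does not depend on the connection). Proof: for the two-parameter
map `x(t, s) = θ(t, c(s))` through a curve `c` with `c(0) = x₀`, `c'(0) = v`, the `t`-curve at
`s = 0` is the constant `x₀` and `x_s(t, 0) = L_t v`; the symmetry lemma `x_{st} = x_{ts}`
(`covariantDerivAlong_velocity_comm`) with `x_t = Y ∘ x` gives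
`(d/dt) L_t v = D_t x_s = D_s x_t = ∇_{x_s} Y = A (L_t v)`, and the solution of `w' = A w`,
`w(0) = v` is `exp(tA) v`.  Hence the hypothesis of `of_isotropy_axis` — `dθ_p|_{x₀} = id` — is the
purely algebraic condition `exp(p ∇Y(x₀)) = 1` on the `g`-skew endomorphism `∇Y(x₀)`. -/

section IsotropyAtZero

variable {E : Type*} [NormedAddCommGroup E] [NormedSpace ℝ E] [FiniteDimensional ℝ E]
  [CompleteSpace E] {M : Type*} [TopologicalSpace M] [ChartedSpace E M]
  [IsManifold 𝓘(ℝ, E) ∞ M] [T2Space M]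

namespace PseudoRiemannianMetric

variable {g : PseudoRiemannianMetric 𝓘(ℝ, E) ∞ E (TangentSpace 𝓘(ℝ, E) : M → Type _)}
  [g.HasLeviCivita] {Y : Π x : M, TangentSpace 𝓘(ℝ, E) x} {θ : ℝ × M → M}

/-- **The differential of the flow at a zero solves `w' = ∇_w Y`.** Let `Y` be a `C^∞` vector
field with `Y x₀ = 0`, `θ` a `C²` flow of `Y` (`θ(0, ·) = id`, `t ↦ θ(t, p)` integral curves) and
`∇` the Levi-Civita connection of a `C^∞` metric `g`. Then `θ_t x₀ = x₀` for all `t`, and for every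
`v ∈ T_{x₀}M` the curve `t ↦ dθ_t|_{x₀} v` in `T_{x₀}M` has derivative `∇_{dθ_t v} Y (x₀)`: with
`x(t, s) = θ(t, c(s))`, `c(0) = x₀`, `c'(0) = v`, one has `x_s(t, 0) = dθ_t v` over the constant
curve `x(t, 0) = x₀`, where `D_t` is the ordinary derivative (`covariantDerivAlong_const_curve`),
and `D_t x_s = D_s x_t = D_s (Y ∘ x) = ∇_{x_s} Y` (`covariantDerivAlong_velocity_comm`,
`covariantDerivAlong_comp_holds`). O'Neill 1983, Ch. 4, Prop. 44 (1) and Ch. 3, Prop. 18 (3);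
the linear isotropy representation of a Killing field at a fixed point, Beig–Chruściel 1997, §1
("`λ^μ_ν` … generates space-rotations") read at an axis point. [cite: ONeillSemiRiemannian1983, Ch. 4, Prop. 44 (1)] -/
theorem hasDerivAt_mfderiv_flow_apply_of_apply_eq_zero
    (hY : ContMDiff 𝓘(ℝ, E) 𝓘(ℝ, E).tangent ∞ (fun x ↦ (⟨x, Y x⟩ : TangentBundle 𝓘(ℝ, E) M)))
    (hθ : ContMDiff (𝓘(ℝ, ℝ).prod 𝓘(ℝ, E)) 𝓘(ℝ, E) 2 θ) (hθ0 : ∀ p, θ (0, p) = p)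
    (hθY : ∀ p, IsMIntegralCurve (fun t ↦ θ (t, p)) Y) {x₀ : M} (hx₀ : Y x₀ = 0)
    (v : TangentSpace 𝓘(ℝ, E) x₀) (t : ℝ) :
    HasDerivAt (fun s ↦ (mfderiv 𝓘(ℝ, E) 𝓘(ℝ, E) (fun q ↦ θ (s, q)) x₀ v : E))
      ((g.leviCivita Y x₀ (mfderiv 𝓘(ℝ, E) 𝓘(ℝ, E) (fun q ↦ θ (t, q)) x₀ v) : E)) t := by
  have hY1 : ContMDiff 𝓘(ℝ, E) 𝓘(ℝ, E).tangent 1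
      (fun x ↦ (⟨x, Y x⟩ : TangentBundle 𝓘(ℝ, E) M)) := hY.of_le (by exact_mod_cast le_top)
  have hfix : ∀ s, θ (s, x₀) = x₀ := fun s ↦
    (eq_flow_of_isMIntegralCurve hY1 hθY hθ0 (isMIntegralCurve_const hx₀) s).symm
  -- realise `v` as `c'(0)` and set `x(t, s) = θ(t, c s)`
  obtain ⟨c, hc0, -, -, hx, hS⟩ := exists_curve_velocity_flow_eq_mfderiv hθ x₀ v
  subst hc0
  set x : ℝ → ℝ → M := fun t s ↦ θ (t, c s) with hx_def
  have hcurve : (fun t' ↦ x t' 0) = fun _ ↦ c 0 := funext fun t' ↦ hfix t'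
  -- the connection is torsion-free and smooth
  have htor : g.leviCivita.torsion = 0 := (isLeviCivita_leviCivita_holds (g := g)).1
  have hcov : g.leviCivita.IsLocallyContMDiff ∞ :=
    isLocallyContMDiff_leviCivita_holds (g := g) ⊤ (by exact_mod_cast (le_top : (⊤ : ℕ∞) + 1 ≤ ⊤))
  -- the symmetry lemma at `(t, 0)`
  have key := covariantDerivAlong_velocity_comm g.leviCivita htor (hx t)
  -- right-hand side: `D_s (Y ∘ x(t, ·)) (0) = ∇_{x_s(t, 0)} Y`
  have hvel : (fun s ↦ velocity 𝓘(ℝ, E) (fun t' ↦ x t' s) t) = fun s ↦ Y (x t s) :=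
    funext fun s ↦ velocity_eq_of_isMIntegralCurve (hθY (c s)) t
  have hγd : MDifferentiableAt 𝓘(ℝ, ℝ) 𝓘(ℝ, E) (x t) 0 :=
    mdifferentiableAt_curry_right (hx t) two_ne_zero
  have hYd : MDiffAt (T% Y) (x t 0) := (hY _).mdifferentiableAt (by simp)
  rw [hvel, covariantDerivAlong_comp_holds (cov := g.leviCivita) hγd hYd] at key
  -- left-hand side: over the constant curve `x(·, 0) = c 0` it is an ordinary derivative
  have hlift : MDifferentiableAt 𝓘(ℝ, ℝ) 𝓘(ℝ, E).tangent
      (fun t' ↦ (TotalSpace.mk' E (x t' 0) (velocity 𝓘(ℝ, E) (x t') 0) :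
        TangentBundle 𝓘(ℝ, E) M)) t :=
    mdifferentiableAt_lift_velocity_curry_right (hx t)
  have hWd : DifferentiableAt ℝ (fun t' ↦ (velocity 𝓘(ℝ, E) (x t') 0 : E)) t := by
    have h := differentiableAt_trivialization_lift
      (trivializationAt E (TangentSpace 𝓘(ℝ, E)) (c 0)) hlift
      (by
        rw [TangentBundle.trivializationAt_baseSet]
        show θ (t, c 0) ∈ (chartAt E (c 0)).source
        rw [hfix]
        exact mem_chart_source E (c 0))
    refine h.congr_of_eventuallyEq (Eventually.of_forall fun t' ↦ ?_)
    exact (trivializationAt_snd_of_eq (hfix t') _).symm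
  have hL := covariantDerivAlong_const_curve g.leviCivita hcov (c 0)
    (W := fun t' ↦ (velocity 𝓘(ℝ, E) (x t') 0 : E)) (t := t) hWd
  rw [hcurve] at key
  -- assemble
  have hderiv : deriv (fun t' ↦ (velocity 𝓘(ℝ, E) (x t') 0 : E)) t =
      (g.leviCivita Y (x t 0) (velocity 𝓘(ℝ, E) (x t) 0) : E) := by
    rw [← hL]
    exact key
  have hW : (fun t' ↦ (velocity 𝓘(ℝ, E) (x t') 0 : E)) =
      fun s ↦ (mfderiv 𝓘(ℝ, E) 𝓘(ℝ, E) (fun q ↦ θ (s, q)) (c 0) v : E) :=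
    funext fun t' ↦ hS t'
  rw [hW] at hWd hderiv
  rw [show x t 0 = c 0 from hfix t, hS t] at hderiv
  rw [← hderiv]
  exact hWd.hasDerivAt

/-- **The linear isotropy action at a zero is the exponential of the covariant differential**:
under the hypotheses of `hasDerivAt_mfderiv_flow_apply_of_apply_eq_zero`,
`dθ_t|_{x₀} = exp(t ∇Y(x₀))` in `End(T_{x₀}M)` for every `t` (both sides solve `L' = ∇Y(x₀) ∘ L`,
`L_0 = id`; uniqueness for linear equations, `Literature.Analysis.ODE.eqOn_of_hasDerivAt_linear`).
The classical description of the isotropy representation of a Killing field at a fixed point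
(Beig–Chruściel 1997, §1, the rotation generated by `λ^μ_ν = lim ∂_ν X^μ`; Kobayashi–Nomizu I,
Ch. VI). [cite: BeigChrusciel1997, §1 (stationary-rotating: λ generates space-rotations)] -/
theorem mfderiv_flow_eq_exp_of_apply_eq_zero
    (hY : ContMDiff 𝓘(ℝ, E) 𝓘(ℝ, E).tangent ∞ (fun x ↦ (⟨x, Y x⟩ : TangentBundle 𝓘(ℝ, E) M)))
    (hθ : ContMDiff (𝓘(ℝ, ℝ).prod 𝓘(ℝ, E)) 𝓘(ℝ, E) 2 θ) (hθ0 : ∀ p, θ (0, p) = p)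
    (hθY : ∀ p, IsMIntegralCurve (fun t ↦ θ (t, p)) Y) {x₀ : M} (hx₀ : Y x₀ = 0) (t : ℝ) :
    @Eq (E →L[ℝ] E) (mfderiv 𝓘(ℝ, E) 𝓘(ℝ, E) (fun q ↦ θ (t, q)) x₀)
      (NormedSpace.exp (𝔸 := E →L[ℝ] E) (t • g.leviCivita Y x₀)) := by
  set A : E →L[ℝ] E := g.leviCivita Y x₀ with hA
  refine ContinuousLinearMap.ext fun (v : E) ↦ ?_
  -- both sides solve `w' = A w` with `w 0 = v`, on `(-(|t| + 1), |t| + 1)`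
  have hT : t ∈ Ioo (-(|t| + 1)) (|t| + 1) := by
    constructor <;> cases abs_cases t <;> linarith
  have h0 : (0 : ℝ) ∈ Ioo (-(|t| + 1)) (|t| + 1) := by
    constructor <;> linarith [abs_nonneg t]
  have h₁ : ∀ s ∈ Ioo (-(|t| + 1)) (|t| + 1),
      HasDerivAt (fun s ↦ (mfderiv 𝓘(ℝ, E) 𝓘(ℝ, E) (fun q ↦ θ (s, q)) x₀ v : E))
        (A (mfderiv 𝓘(ℝ, E) 𝓘(ℝ, E) (fun q ↦ θ (s, q)) x₀ v)) s := fun s _ ↦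
    hasDerivAt_mfderiv_flow_apply_of_apply_eq_zero hY hθ hθ0 hθY hx₀ v s
  have h₂ : ∀ s ∈ Ioo (-(|t| + 1)) (|t| + 1),
      HasDerivAt (fun s ↦ NormedSpace.exp (s • A) v) (A (NormedSpace.exp (s • A) v)) s := by
    intro s _
    have h := (hasDerivAt_exp_smul_const' A s).clm_apply (hasDerivAt_const s v)
    rw [map_zero, add_zero] at h
    exact h
  have heq : (mfderiv 𝓘(ℝ, E) 𝓘(ℝ, E) (fun q ↦ θ (0, q)) x₀ v : E) = NormedSpace.exp ((0 : ℝ) • A) v := by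
    rw [zero_smul, NormedSpace.exp_zero, show (fun q ↦ θ (0, q)) = id from funext hθ0, mfderiv_id]
    rfl
  exact Literature.Analysis.ODE.eqOn_of_hasDerivAt_linear (B := fun _ ↦ A) h0 continuousOn_const
    h₁ h₂ heq hT

end PseudoRiemannianMetric

end IsotropyAtZero

/-- **Reduction of the Beig–Chruściel combination to an algebraic condition at an axis point.**
`BeigChrusciel1997_axisymmetricCombination` follows from: for every `𝓑`, `K` as there, some
`Y = a • T + b • K` with `b ≠ 0` has a zero `x₀` at which `exp(p ∇Y(x₀)) = 1` for some `p ≠ 0`,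
i.e. the `g`-skew endomorphism `∇Y(x₀)` of `T_{x₀}M` generates a closed one-parameter subgroup
(a rotation) — by `mfderiv_flow_eq_exp_of_apply_eq_zero` this is the periodicity of the linear
isotropy action, and `of_isotropy_axis` concludes. [cite: BeigChrusciel1997, Thm. 1.1 (3), Props. 2.3–2.4 and proof of Thm. 1.2, case (ii)] -/
theorem BeigChrusciel1997_axisymmetricCombination.of_exp_axis.{v}
    (h : ∀ (𝓑 : StationaryAFBlackHole.{v}) [𝓑.metric.HasLeviCivita],
      𝓑.IsIPlusRegularNonDegenerate → 𝓑.metric.toPseudoRiemannianMetric.IsRicciFlat →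
      ∀ K : Π x : 𝓑.carrier, TangentSpace (𝓡 4) x,
        𝓑.metric.IsKillingField K → IsCompleteVectorField K →
        (∀ x, VectorField.mlieBracket (𝓡 4) 𝓑.killing K x = 0) →
        (¬ ∃ c : ℝ, K = c • 𝓑.killing) →
        ∃ a b p : ℝ, b ≠ 0 ∧ p ≠ 0 ∧ ∃ x₀, (a • 𝓑.killing + b • K) x₀ = 0 ∧
          NormedSpace.exp (𝔸 := EuclideanSpace ℝ (Fin 4) →L[ℝ] EuclideanSpace ℝ (Fin 4))
            (p • 𝓑.metric.leviCivita (a • 𝓑.killing + b • K) x₀) = 1) :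
    BeigChrusciel1997_axisymmetricCombination.{v} := by
  refine BeigChrusciel1997_axisymmetricCombination.of_isotropy_axis
    fun 𝓑 _ hreg hvac K hK hKc hcomm hrot ↦ ?_
  obtain ⟨a, b, p, hb, hp, x₀, hx₀, hexp⟩ := h 𝓑 hreg hvac K hK hKc hcomm hrot
  refine ⟨a, b, p, hb, hp, x₀, hx₀, fun θ hθ hθ0 hθY w ↦ ?_⟩
  have hY : 𝓑.metric.IsKillingField (a • 𝓑.killing + b • K) :=
    𝓑.isStationaryKilling.isKillingField.linearCombination hK a b
  have key := PseudoRiemannianMetric.mfderiv_flow_eq_exp_of_apply_eq_zero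
    (g := 𝓑.metric.toPseudoRiemannianMetric) hY.contMDiff
    (hθ.of_le (ENat.LEInfty.out : (2 : ℕ∞ω) ≤ ∞)) hθ0 hθY hx₀ p
  rw [hexp] at key
  exact congrFun (congrArg DFunLike.coe key) w

/-- **The reduction is lossless**: conversely, the named fact implies the algebraic condition of
`of_exp_axis` — given an axisymmetric combination `Y = a • T + b • K` (all orbits `2π`-periodic,
an axis point `x₀`), its `C^∞` global flow satisfies `θ_{2π} = id`, so
`exp(2π ∇Y(x₀)) = dθ_{2π}|_{x₀} = id` (`mfderiv_flow_eq_exp_of_apply_eq_zero`). Hence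
`BeigChrusciel1997_axisymmetricCombination` is *equivalent* to the pointwise-algebraic statement.
[cite: BeigChrusciel1997, Thm. 1.2 with Props. 2.3–2.4] -/
theorem BeigChrusciel1997_axisymmetricCombination.iff_exp_axis.{v} :
    BeigChrusciel1997_axisymmetricCombination.{v} ↔
    ∀ (𝓑 : StationaryAFBlackHole.{v}) [𝓑.metric.HasLeviCivita],
      𝓑.IsIPlusRegularNonDegenerate → 𝓑.metric.toPseudoRiemannianMetric.IsRicciFlat →
      ∀ K : Π x : 𝓑.carrier, TangentSpace (𝓡 4) x,
        𝓑.metric.IsKillingField K → IsCompleteVectorField K →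
        (∀ x, VectorField.mlieBracket (𝓡 4) 𝓑.killing K x = 0) →
        (¬ ∃ c : ℝ, K = c • 𝓑.killing) →
        ∃ a b p : ℝ, b ≠ 0 ∧ p ≠ 0 ∧ ∃ x₀, (a • 𝓑.killing + b • K) x₀ = 0 ∧
          NormedSpace.exp (𝔸 := EuclideanSpace ℝ (Fin 4) →L[ℝ] EuclideanSpace ℝ (Fin 4))
            (p • 𝓑.metric.leviCivita (a • 𝓑.killing + b • K) x₀) = 1 := by
  refine ⟨fun hBC 𝓑 _ hreg hvac K hK hKc hcomm hrot ↦ ?_,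
    BeigChrusciel1997_axisymmetricCombination.of_exp_axis⟩
  obtain ⟨a, b, hb, hc, hper, x₀, hx₀⟩ := hBC 𝓑 hreg hvac K hK hKc hcomm hrot
  have hY : 𝓑.metric.IsKillingField (a • 𝓑.killing + b • K) :=
    𝓑.isStationaryKilling.isKillingField.linearCombination hK a b
  -- the smooth global flow of the combination; all orbits `2π`-periodic force `θ_{2π} = id`
  obtain ⟨θ, hθ, hθ0, -, hθY⟩ :=
    Literature.Geometry.Manifold.exists_contMDiff_globalFlow_of_complete (n := ⊤) hY.contMDiff
      (by exact_mod_cast le_top) fun x ↦ by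
        obtain ⟨γ, hγ, h0⟩ := hc x
        exact ⟨γ, h0, hγ⟩
  have hid : (fun q ↦ θ (2 * Real.pi, q)) = id := funext fun q ↦ by
    have h : θ (0 + 2 * Real.pi, q) = θ (0, q) := hper (fun t ↦ θ (t, q)) (hθY q) 0
    rw [zero_add, hθ0] at h
    exact h
  refine ⟨a, b, 2 * Real.pi, hb, by positivity, x₀, hx₀, ?_⟩
  rw [← PseudoRiemannianMetric.mfderiv_flow_eq_exp_of_apply_eq_zero
    (g := 𝓑.metric.toPseudoRiemannianMetric) hY.contMDiff
    (hθ.of_le (ENat.LEInfty.out : (2 : ℕ∞ω) ≤ ∞)) hθ0 hθY hx₀ (2 * Real.pi), hid, mfderiv_id]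
  rfl

/-! ### Killing fields form a Lie algebra (the algebra `𝔏` of Beig–Chruściel's proof)

Beig–Chruściel's case analysis runs in the Lie algebra `𝔏` of complete Killing fields and uses
that brackets of Killing fields are Killing fields (proof of Thm. 1.2, case (iii): "It follows that
`[X₁, X₂]` is a Killing vector linearly independent of `X₁` and `X₂` near infinity"; and the
`so(3)` relations `[X_i, X_j] = ε_{ijk} X_k` of the three-dimensional case).  O'Neill 1983, Ch. 9,
Lemma 9.28 ff. records the Killing fields as a Lie algebra `𝔦(M)`; in the connection formalism of
the tree the Killing equation for `[X, Y] = ∇_X Y - ∇_Y X` follows from the Killing identity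
`∇_V ∇_W X - ∇_{∇_V W} X = R(V, X) W` (O'Neill Ch. 9, Ex. 8, `IsKillingField.leviCivita₂_eq_riemann`),
the first Bianchi identity and the skew-adjointness of `R(X, Y)`. -/

section KillingLieAlgebra

variable {E : Type*} [NormedAddCommGroup E] [NormedSpace ℝ E] [FiniteDimensional ℝ E]
  [CompleteSpace E] {H : Type*} [TopologicalSpace H] {I : ModelWithCorners ℝ E H}
  {M : Type*} [TopologicalSpace M] [ChartedSpace H M] [IsManifold I ∞ M] {n : ℕ∞ω} [Fact (1 ≤ n)]

namespace PseudoRiemannianMetric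

variable {g : PseudoRiemannianMetric I n E (TangentSpace I : M → Type _)} [g.HasLeviCivita]
  {X Y : Π x : M, TangentSpace I x}
/-- **The covariant derivative of a bracket of Killing fields**: for Killing fields `X`, `Y` of a
`C^n` metric, `n ≥ 2`, `∇_{V₀} [X, Y] = R(V₀, Y) X - R(V₀, X) Y + ∇_{∇_{V₀} X} Y - ∇_{∇_{V₀} Y} X`
(torsion-freeness `[X, Y] = ∇_X Y - ∇_Y X` and the Killing identity `∇_V ∇_W X - ∇_{∇_V W} X =
R(V, X) W`, O'Neill 1983, Ch. 9, Ex. 8, applied to `X` and to `Y`). [cite: ONeillSemiRiemannian1983, Ch. 9, Ex. 8] -/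
theorem IsKillingField.leviCivita_mlieBracket_apply (hX : g.IsKillingField X)
    (hY : g.IsKillingField Y) (hn : 2 ≤ n) (x : M) (V₀ : TangentSpace I x) :
    g.leviCivita (mlieBracket I X Y) x V₀ =
      g.riemann x V₀ (Y x) (X x) - g.riemann x V₀ (X x) (Y x)
        + g.leviCivita Y x (g.leviCivita X x V₀) - g.leviCivita X x (g.leviCivita Y x V₀) := by
  have hLC : g.IsLeviCivita g.leviCivita := isLeviCivita_leviCivita_holds
  have hbr : mlieBracket I X Y =
      (fun y ↦ g.leviCivita Y y (X y)) + (-1 : ℝ) • (fun y ↦ g.leviCivita X y (Y y)) := by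
    funext y
    have h := (g.leviCivita.torsion_eq_zero_iff).1 hLC.1 (hX.mdifferentiableAt y)
      (hY.mdifferentiableAt y)
    show mlieBracket I X Y y = g.leviCivita Y y (X y) + (-1 : ℝ) • g.leviCivita X y (Y y)
    rw [neg_one_smul, ← sub_eq_add_neg]
    exact h.symm
  have hA : MDiffAt (T% fun y ↦ g.leviCivita Y y (X y)) x :=
    mdifferentiableAt_leviCivita_apply hn (hY.contMDiff_two hn) (hX.mdifferentiableAt x)
  have hB : MDiffAt (T% fun y ↦ g.leviCivita X y (Y y)) x :=
    mdifferentiableAt_leviCivita_apply hn (hX.contMDiff_two hn) (hY.mdifferentiableAt x)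
  rw [hbr, g.leviCivita.isCovariantDerivativeOnUniv.add hA hB.smul_const_section,
    g.leviCivita.isCovariantDerivativeOnUniv.smul_const (-1) hB]
  have h1 := hY.leviCivita₂_eq_riemann hn (hX.mdifferentiableAt x) V₀
  have h2 := hX.leviCivita₂_eq_riemann hn (hY.mdifferentiableAt x) V₀
  rw [sub_eq_iff_eq_add] at h1 h2
  rw [add_apply, smul_apply, h1, h2, neg_one_smul]
  abel

/-- **The bracket of two Killing fields satisfies the Killing equation** (`C^n` metric, `n ≥ 2`):
`g(∇_{V₀} [X, Y], W₀) + g(V₀, ∇_{W₀} [X, Y]) = 0`.  With `leviCivita_mlieBracket_apply`, the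
first-order terms cancel by the Killing equations of `X` and `Y`, and the curvature terms reduce,
by the first Bianchi identity, to `g(R(X, Y) V₀, W₀) + g(V₀, R(X, Y) W₀) = 0` (skew-adjointness
of `R(X, Y)`, O'Neill 1983, Ch. 3, Prop. 3.36). O'Neill 1983, Ch. 9, Lemma 9.28 ff. (the Lie
algebra `𝔦(M)` of Killing fields). [cite: ONeillSemiRiemannian1983, Ch. 9, Lemma 9.28 and Ch. 3, Prop. 3.36] -/
theorem IsKillingField.killingEquation_mlieBracket (hX : g.IsKillingField X)
    (hY : g.IsKillingField Y) (hn : 2 ≤ n) (x : M) (V₀ W₀ : TangentSpace I x) :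
    g.val x (g.leviCivita (mlieBracket I X Y) x V₀) W₀ +
      g.val x V₀ (g.leviCivita (mlieBracket I X Y) x W₀) = 0 := by
  have hLC : g.IsLeviCivita g.leviCivita := isLeviCivita_leviCivita_holds
  rw [hX.leviCivita_mlieBracket_apply hY hn x V₀, hX.leviCivita_mlieBracket_apply hY hn x W₀]
  -- Killing equations (first-order terms)
  have kY1 := hY.val_leviCivita_add x (g.leviCivita X x V₀) W₀
  have kX1 := hX.val_leviCivita_add x (g.leviCivita Y x V₀) W₀
  have kY2 := hY.val_leviCivita_add x V₀ (g.leviCivita X x W₀)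
  have kX2 := hX.val_leviCivita_add x V₀ (g.leviCivita Y x W₀)
  -- curvature terms: first Bianchi and antisymmetry give `R(V,Y)X - R(V,X)Y = R(X,Y)V`
  have bianchi : ∀ V : TangentSpace I x,
      g.riemann x V (Y x) (X x) - g.riemann x V (X x) (Y x) = g.riemann x (X x) (Y x) V := by
    intro V
    have h := hLC.curvature_first_bianchi hn x V (Y x) (X x)
    rw [g.leviCivita.curvature_antisymm (X x) V (Y x),
      g.leviCivita.curvature_antisymm (Y x) (X x) V] at h
    change g.leviCivita.curvature x V (Y x) (X x) - g.leviCivita.curvature x V (X x) (Y x) =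
      g.leviCivita.curvature x (X x) (Y x) V
    rw [← sub_eq_zero, ← h]
    abel
  -- skew-adjointness of `R(X,Y)` and symmetry of `g`
  have s1 : g.val x (g.riemann x (X x) (Y x) V₀) W₀ = -g.val x (g.riemann x (X x) (Y x) W₀) V₀ :=
    hLC.val_curvature_skew hn x (X x) (Y x) V₀ W₀
  have s2 : g.val x V₀ (g.riemann x (X x) (Y x) W₀) = g.val x (g.riemann x (X x) (Y x) W₀) V₀ :=
    g.symm x _ _
  rw [bianchi V₀, bianchi W₀]
  simp only [map_add, map_sub, add_apply, sub_apply]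
  linear_combination kY1 - kX1 + kY2 - kX2 + s1 + s2

end PseudoRiemannianMetric

/-- **Killing fields of a smooth metric form a Lie algebra**: the bracket `[X, Y]` of two Killing
fields is a Killing field (O'Neill 1983, Ch. 9, Lemma 9.28 ff., the Lie algebra `𝔦(M)`; used by
Beig–Chruściel 1997 throughout the proof of Thm. 1.2, e.g. case (iii)). Smoothness of the bracket
is Mathlib's `ContMDiffAt.mlieBracket_vectorField`; the Killing equation is
`killingEquation_mlieBracket` (named like Mathlib's closure lemmas, so that `mlieBracket` keeps
resolving to `VectorField.mlieBracket` inside `IsKillingField.*` declarations). [cite: ONeillSemiRiemannian1983, Ch. 9, Lemma 9.28] -/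
theorem PseudoRiemannianMetric.IsKillingField.mlieBracket_vectorField
    {g : PseudoRiemannianMetric I ∞ E (TangentSpace I : M → Type _)} [g.HasLeviCivita]
    {X Y : Π x : M, TangentSpace I x} (hX : g.IsKillingField X) (hY : g.IsKillingField Y) :
    g.IsKillingField (VectorField.mlieBracket I X Y) := by
  refine ⟨fun x ↦ ?_, fun x V₀ W₀ ↦
    hX.killingEquation_mlieBracket hY (ENat.LEInfty.out : (2 : ℕ∞ω) ≤ ∞) x V₀ W₀⟩
  haveI : IsManifold I (((⊤ : ℕ∞) : ℕ∞ω) + 1) M := by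
    rw [show (((⊤ : ℕ∞) : ℕ∞ω) + 1 : ℕ∞ω) = ∞ by rfl]; infer_instance
  haveI : IsManifold I (minSmoothness ℝ 2) M := by
    rw [minSmoothness_of_isRCLikeNormedField]; infer_instance
  have hXx : CMDiffAt ((⊤ : ℕ∞) : ℕ∞ω) (T% X) x := hX.contMDiff x
  have hYx : CMDiffAt ((⊤ : ℕ∞) : ℕ∞ω) (T% Y) x := hY.contMDiff x
  exact hXx.mlieBracket_vectorField hYx (m := ⊤) (by simp)

/-- The Killing fields of a stationary asymptotically flat black hole commuting with the
stationary field are closed under brackets with any further Killing field: `[T, K]` is again a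
Killing field (the ambient Lie algebra `𝔏` of Beig–Chruściel's proof of Thm. 1.2).
[cite: BeigChrusciel1997, proof of Thm. 1.2] -/
theorem StationaryAFBlackHole.isKillingField_mlieBracket_killing (𝓑 : StationaryAFBlackHole)
    [𝓑.metric.HasLeviCivita]
    {K : Π x : 𝓑.carrier, TangentSpace (𝓡 4) x} (hK : 𝓑.metric.IsKillingField K) :
    𝓑.metric.IsKillingField (mlieBracket (𝓡 4) 𝓑.killing K) :=
  𝓑.isStationaryKilling.isKillingField.mlieBracket_vectorField hK

end KillingLieAlgebra

/-! ### A complete Killing field is determined by its one-jet at a point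

Beig–Chruściel's case analysis is by the dimension of the Lie algebra `𝔏` of (complete) Killing
fields, finite because a Killing field is determined by `(X(x₀), ∇X(x₀))` (O'Neill 1983, Ch. 9,
Lemma 9.28 and Prop. 9.27 ff.; Kobayashi–Nomizu I, Ch. VI, Thm. 3.3).  With the isotropy
description `dθ_t|_{x₀} = exp(t ∇X(x₀))` and the one-jet rigidity of isometries this is immediate
for complete fields on a connected manifold. -/

section OneJetVanishing

variable {E : Type*} [NormedAddCommGroup E] [NormedSpace ℝ E] [FiniteDimensional ℝ E]
  [CompleteSpace E] {M : Type*} [TopologicalSpace M] [ChartedSpace E M]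
  [IsManifold 𝓘(ℝ, E) ∞ M] [T2Space M] [ConnectedSpace M]

namespace PseudoRiemannianMetric

variable {g : PseudoRiemannianMetric 𝓘(ℝ, E) ∞ E (TangentSpace 𝓘(ℝ, E) : M → Type _)}
  [g.HasLeviCivita] {X Y : Π x : M, TangentSpace 𝓘(ℝ, E) x}

/-- **The flow of a complete Killing field with vanishing one-jet at a point is trivial**: if
`X x₀ = 0` and `∇X(x₀) = 0` then every `C^∞` flow `θ` of `X` with `θ_0 = id` is the identity,
`θ_t = id` for all `t` (`dθ_t|_{x₀} = exp(t ∇X(x₀)) = 1` by `mfderiv_flow_eq_exp_of_apply_eq_zero`,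
then one-jet rigidity of the isometric immersion `θ_t`, O'Neill 1983, Ch. 3, Prop. 3.62).
[cite: ONeillSemiRiemannian1983, Ch. 3, Prop. 3.62 and Ch. 9, Lemma 9.28] -/
theorem IsKillingField.flow_eq_self_of_oneJet_eq_zero (hX : g.IsKillingField X)
    {θ : ℝ × M → M} (hθ : ContMDiff (𝓘(ℝ, ℝ).prod 𝓘(ℝ, E)) 𝓘(ℝ, E) ∞ θ)
    (hθ0 : ∀ p, θ (0, p) = p) (hθX : ∀ p, IsMIntegralCurve (fun t ↦ θ (t, p)) X)
    {x₀ : M} (hx₀ : X x₀ = 0) (hd : g.leviCivita X x₀ = 0) (t : ℝ) (x : M) : θ (t, x) = x := by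
  have hfix : θ (t, x₀) = x₀ := hX.flow_apply_eq_of_apply_eq_zero hθ0 hθX hx₀ t
  refine hX.flow_apply_eq_self_of_oneJet hθ hθ0 hθX hfix (fun w ↦ ?_) x
  have hexp := mfderiv_flow_eq_exp_of_apply_eq_zero (g := g) hX.contMDiff
    (hθ.of_le (ENat.LEInfty.out : (2 : ℕ∞ω) ≤ ∞)) hθ0 hθX hx₀ t
  have h1 : NormedSpace.exp (𝔸 := E →L[ℝ] E) (t • g.leviCivita X x₀) = 1 := by
    rw [hd, smul_zero]
    exact NormedSpace.exp_zero
  rw [h1] at hexp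
  exact congrFun (congrArg DFunLike.coe hexp) w

/-- **A complete Killing field on a connected manifold is determined by its one-jet at one point**
(vanishing form): `X x₀ = 0` and `∇X(x₀) = 0` imply `X = 0`.  O'Neill 1983, Ch. 9, Lemma 9.28
(the evaluation `X ↦ (X_p, (∇X)_p)` is injective on `𝔦(M)`, whence `dim 𝔦(M) ≤ n(n+1)/2`);
Kobayashi–Nomizu I, Ch. VI, Thm. 3.3; implicit in Beig–Chruściel's count of `dim 𝔏`.  (Here via
the global flow of the complete field, `Literature.Geometry.Manifold.exists_contMDiff_globalFlow_of_complete`,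
and `flow_eq_self_of_oneJet_eq_zero`.) [cite: ONeillSemiRiemannian1983, Ch. 9, Lemma 9.28] -/
theorem IsKillingField.eq_zero_of_oneJet_eq_zero (hX : g.IsKillingField X)
    (hXc : IsCompleteVectorField X) {x₀ : M} (hx₀ : X x₀ = 0) (hd : g.leviCivita X x₀ = 0) :
    X = 0 := by
  obtain ⟨θ, hθ, hθ0, -, hθX⟩ :=
    Literature.Geometry.Manifold.exists_contMDiff_globalFlow_of_complete (n := ⊤) hX.contMDiff
      (by exact_mod_cast le_top) fun x ↦ by
        obtain ⟨γ, hγ, h0⟩ := hXc x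
        exact ⟨γ, h0, hγ⟩
  funext x
  have hc : (fun t ↦ θ (t, x)) = fun _ ↦ x :=
    funext fun t ↦ hX.flow_eq_self_of_oneJet_eq_zero hθ hθ0 hθX hx₀ hd t x
  have hconst : IsMIntegralCurve (fun _ : ℝ ↦ x) X := hc ▸ hθX x
  have h0 : (1 : ℝ →L[ℝ] ℝ).smulRight (X x) = (0 : ℝ →L[ℝ] TangentSpace 𝓘(ℝ, E) x) :=
    hasMFDerivAt_unique (hconst 0) (hasMFDerivAt_const (I := 𝓘(ℝ, ℝ)) (I' := 𝓘(ℝ, E)) x 0)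
  simpa using congrArg (fun L : ℝ →L[ℝ] TangentSpace 𝓘(ℝ, E) x ↦ L 1) h0

/-- **Injectivity of the one-jet on commuting complete Killing fields**: two complete Killing
fields with `[X, Y] = 0` and the same one-jet at a point coincide (`X - Y` is then a complete
Killing field, `isCompleteVectorField_linearCombination_of_mlieBracket_eq_zero`, with vanishing
one-jet). O'Neill 1983, Ch. 9, Lemma 9.28. [cite: ONeillSemiRiemannian1983, Ch. 9, Lemma 9.28] -/
theorem IsKillingField.eq_of_oneJet_eq_of_mlieBracket_eq_zero (hX : g.IsKillingField X)
    (hY : g.IsKillingField Y) (hXc : IsCompleteVectorField X) (hYc : IsCompleteVectorField Y)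
    (hcomm : ∀ x, VectorField.mlieBracket 𝓘(ℝ, E) X Y x = 0) {x₀ : M} (h₀ : X x₀ = Y x₀)
    (h₁ : g.leviCivita X x₀ = g.leviCivita Y x₀) : X = Y := by
  have hsub : X - Y = (1 : ℝ) • X + (-1 : ℝ) • Y := by
    funext x; simp [sub_eq_add_neg]
  have hK : g.IsKillingField (X - Y) := hX.sub hY
  have hKc : IsCompleteVectorField (X - Y) := by
    rw [hsub]
    exact isCompleteVectorField_linearCombination_of_mlieBracket_eq_zero hX.contMDiff hY.contMDiff
      hcomm hXc hYc 1 (-1)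
  have hzero : (X - Y) x₀ = 0 := by simp [h₀]
  have hd : g.leviCivita (X - Y) x₀ = 0 := by
    rw [g.leviCivita.apply_sub_section (hX.mdifferentiableAt x₀) (hY.mdifferentiableAt x₀), h₁,
      sub_self]
  exact sub_eq_zero.1 (hK.eq_zero_of_oneJet_eq_zero hKc hzero hd)

end PseudoRiemannianMetric

end OneJetVanishing

/-! ### Infinitesimal rotations: reduction to an axis point in the stationary region

Beig–Chruściel normalise the rotational Killing field through its asymptotic generator
`λ^μ_ν = lim ∂_ν X^μ`: "`λ^μ_ν p^ν = 0`, so that `λ` generates space-rotations (leaving `p`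
invariant)" (§1), and an element of `so(3)` generates a closed one-parameter group.  The same
algebra at an axis point `x₀` of `Y = a • T + b • K` — where `A = ∇Y(x₀)` is `g`-skew and kills
the timelike vector `T(x₀)` — turns the hypothesis `exp(p ∇Y(x₀)) = 1` of `of_exp_axis` into the
mere existence of an axis point at which `T` is timelike (`of_timelike_axis`).  The algebra:
Rodrigues' formula `exp(tA) = 1 + (sin κt/κ) A + ((1 - cos κt)/κ²) A²` from `A³ = -κ² A`, and the
cube law `A³ = -κ² A` for a skew endomorphism of a Euclidean `3`-space (`3 × 3` skew matrices). -/

section RotationGenerator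

/-- **Rodrigues' formula in a Banach algebra**: if `A³ = -κ² A` with `κ ≠ 0` then
`exp(tA) = 1 + (sin κt / κ) A + ((1 - cos κt) / κ²) A²` (both sides solve `X' = A X`, `X(0) = 1`;
uniqueness for linear equations). The classical formula for the exponential of an infinitesimal
rotation. [folklore] -/
theorem exp_smul_eq_of_mul_mul_self_eq {𝔸 : Type*} [NormedRing 𝔸] [NormedAlgebra ℝ 𝔸]
    [CompleteSpace 𝔸] (A : 𝔸) {κ : ℝ} (hκ : κ ≠ 0) (hA : A * A * A = -(κ ^ 2) • A) (t : ℝ) :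
    NormedSpace.exp (t • A) =
      1 + (Real.sin (κ * t) / κ) • A + ((1 - Real.cos (κ * t)) / κ ^ 2) • (A * A) := by
  set F : ℝ → 𝔸 := fun t ↦
    1 + (Real.sin (κ * t) / κ) • A + ((1 - Real.cos (κ * t)) / κ ^ 2) • (A * A) with hF
  have hT : t ∈ Ioo (-(|t| + 1)) (|t| + 1) := by
    constructor <;> cases abs_cases t <;> linarith
  have h0 : (0 : ℝ) ∈ Ioo (-(|t| + 1)) (|t| + 1) := by
    constructor <;> linarith [abs_nonneg t]
  have h₁ : ∀ s ∈ Ioo (-(|t| + 1)) (|t| + 1), HasDerivAt (fun s : ℝ ↦ NormedSpace.exp (s • A))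
      ((fun _ : ℝ ↦ ContinuousLinearMap.mul ℝ 𝔸 A) s (NormedSpace.exp (s • A))) s := fun s _ ↦ by
    simpa only [ContinuousLinearMap.mul_apply'] using hasDerivAt_exp_smul_const' A s
  have h₂ : ∀ s ∈ Ioo (-(|t| + 1)) (|t| + 1), HasDerivAt F
      ((fun _ : ℝ ↦ ContinuousLinearMap.mul ℝ 𝔸 A) s (F s)) s := by
    intro s _
    have hs : HasDerivAt (fun y ↦ Real.sin (κ * y) / κ) (Real.cos (κ * s)) s :=
      ((((hasDerivAt_id' s).const_mul κ).sin).div_const κ).congr_deriv (by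
        rw [mul_one, mul_div_assoc, div_self hκ, mul_one])
    have hc : HasDerivAt (fun y ↦ (1 - Real.cos (κ * y)) / κ ^ 2) (Real.sin (κ * s) / κ) s :=
      (((((hasDerivAt_id' s).const_mul κ).cos).const_sub 1).div_const (κ ^ 2)).congr_deriv (by
        rw [mul_one, neg_mul, neg_neg, pow_two, mul_div_mul_right _ _ hκ])
    have hF' := ((hasDerivAt_const s (1 : 𝔸)).add (hs.smul_const A)).add (hc.smul_const (A * A))
    have key : A * F s = Real.cos (κ * s) • A + (Real.sin (κ * s) / κ) • (A * A) := by
      have hAAA : A * (A * A) = -(κ ^ 2) • A := by rw [← mul_assoc]; exact hA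
      simp only [hF, mul_add, mul_one, mul_smul_comm, hAAA, smul_smul]
      have hcoef : (1 - Real.cos (κ * s)) / κ ^ 2 * -κ ^ 2 = Real.cos (κ * s) - 1 := by
        field_simp
        ring
      rw [hcoef, sub_smul, one_smul]
      abel
    refine hF'.congr_deriv ?_
    simp only [ContinuousLinearMap.mul_apply', key, zero_add]
  have heq : NormedSpace.exp ((0 : ℝ) • A) = F 0 := by
    simp [hF]
  exact Literature.Analysis.ODE.eqOn_of_hasDerivAt_linear
    (B := fun _ : ℝ ↦ ContinuousLinearMap.mul ℝ 𝔸 A) h0 continuousOn_const h₁ h₂ heq hT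

/-- **An infinitesimal rotation generates a closed one-parameter group**: if `A³ = -κ² A` with
`κ ≠ 0` then `exp((2π/κ) A) = 1`. [folklore] -/
theorem exp_smul_eq_one_of_mul_mul_self_eq {𝔸 : Type*} [NormedRing 𝔸] [NormedAlgebra ℝ 𝔸]
    [CompleteSpace 𝔸] (A : 𝔸) {κ : ℝ} (hκ : κ ≠ 0) (hA : A * A * A = -(κ ^ 2) • A) :
    NormedSpace.exp ((2 * Real.pi / κ) • A) = 1 := by
  rw [exp_smul_eq_of_mul_mul_self_eq A hκ hA, show κ * (2 * Real.pi / κ) = 2 * Real.pi by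
    field_simp, Real.sin_two_pi, Real.cos_two_pi]
  simp

/-- The cube of a `3 × 3` skew-symmetric real matrix: `M³ = -(a² + b² + c²) M`. [folklore] -/
theorem skewMatrix_fin_three_mul_mul_self (a b c : ℝ) :
    !![0, a, b; -a, 0, c; -b, -c, 0] * !![0, a, b; -a, 0, c; -b, -c, 0] *
        !![0, a, b; -a, 0, c; -b, -c, 0] =
      -(a ^ 2 + b ^ 2 + c ^ 2) • !![0, a, b; -a, 0, c; -b, -c, 0] := by
  ext i j
  fin_cases i <;> fin_cases j <;> simp [Matrix.mul_apply, Fin.sum_univ_three] <;> ring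

/-- For a basis `e` which is orthonormal for a bilinear pairing `B`, the coordinates are the
pairings: `e.repr w i = B (e i) w`. [folklore] -/
theorem basisRepr_eq_of_orthonormal {ι V : Type*} [Fintype ι] [DecidableEq ι]
    [AddCommGroup V] [Module ℝ V] (e : Module.Basis ι ℝ V) (B : V →ₗ[ℝ] V →ₗ[ℝ] ℝ)
    (he : ∀ i j, B (e i) (e j) = if i = j then 1 else 0) (w : V) (i : ι) :
    e.repr w i = B (e i) w := by
  have h := congrArg (B (e i)) (e.sum_repr w).symm
  rw [h, map_sum]
  simp only [map_smul, smul_eq_mul, he, mul_ite, mul_one, mul_zero, Finset.sum_ite_eq,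
    Finset.mem_univ, if_true]

/-- **An infinitesimal Lorentz transformation fixing a timelike vector is an infinitesimal
rotation and generates a closed one-parameter group.** Let `B` be a symmetric bilinear form on a
real `4`-space `V` which is negative on `p` and positive definite on `p^⊥` (Lorentzian, `p`
timelike), and `A` a `B`-skew endomorphism with `A p = 0`. Then `A³ = -κ² A` for some `κ ≥ 0`
(`A` is a rotation generator in the Euclidean `3`-space `p^⊥`), and `exp(τ A) = 1` for some
`τ ≠ 0`. Beig–Chruściel 1997, §1: "`λ^μ_ν p^ν = 0`, so that `λ` generates space-rotations";
O'Neill 1983, Ch. 9, pp. 236–237 (the Lorentz group, isotropy of a timelike vector is `O(3)`).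
[cite: BeigChrusciel1997, §1 (stationary–rotating case)] -/
theorem exists_exp_smul_eq_one_of_skew_of_apply_eq_zero
    {V : Type*} [NormedAddCommGroup V] [NormedSpace ℝ V] [FiniteDimensional ℝ V]
    (hV : Module.finrank ℝ V = 4) (B : V →L[ℝ] V →L[ℝ] ℝ) (hBsymm : ∀ v w, B v w = B w v)
    {p : V} (hp : B p p < 0) (hpos : ∀ w, B p w = 0 → w ≠ 0 → 0 < B w w)
    (A : V →L[ℝ] V) (hA : ∀ v w, B (A v) w + B v (A w) = 0) (hAp : A p = 0) :
    ∃ τ : ℝ, τ ≠ 0 ∧ NormedSpace.exp (τ • A) = 1 := by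
  classical
  -- the cube law `A³ = -s A`, `s ≥ 0`, with `s = 0 → A = 0`
  obtain ⟨s, hs0, hcube, hzero⟩ :
      ∃ s : ℝ, 0 ≤ s ∧ A * A * A = -s • A ∧ (s = 0 → A = 0) := by
    -- the `B`-orthogonal complement `W` of `p`
    set f : V →ₗ[ℝ] ℝ := ((B p : V →L[ℝ] ℝ) : V →ₗ[ℝ] ℝ) with hf
    have hfapply : ∀ v, f v = B p v := fun v ↦ rfl
    obtain ⟨W, hWdef⟩ : ∃ W : Submodule ℝ V, W = LinearMap.ker f := ⟨_, rfl⟩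
    have hW : ∀ w, w ∈ W ↔ B p w = 0 := fun w ↦ by rw [hWdef, LinearMap.mem_ker, hfapply]
    -- `A` preserves `W`
    have hAW : ∀ w ∈ W, (A : V →ₗ[ℝ] V) w ∈ W := by
      intro w hw
      rw [hW] at hw ⊢
      have h := hA p w
      rwa [hAp, map_zero, zero_apply, zero_add] at h
    -- every vector is `c • p + w`, `w ∈ W`
    have hdec : ∀ v, v - (B p v / B p p) • p ∈ W := by
      intro v
      rw [hW, map_sub, map_smul, smul_eq_mul, div_mul_cancel₀ _ hp.ne]
      exact sub_self _
    -- `dim W = 3`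
    have hW3 : Module.finrank ℝ W = 3 := by
      have h1 := LinearMap.finrank_range_add_finrank_ker f
      have hr : LinearMap.range f = ⊤ := by
        rw [LinearMap.range_eq_top]
        intro c
        refine ⟨(c / B p p) • p, ?_⟩
        rw [map_smul, hfapply, smul_eq_mul, div_mul_cancel₀ _ hp.ne]
      rw [hr, finrank_top, Module.finrank_self, hV, ← hWdef] at h1
      omega
    -- `B` restricted to `W` is a positive definite symmetric bilinear form: orthonormal basis
    have hposW : ∀ w : W, w ≠ 0 → 0 < B (w : V) w := fun w hw ↦
      hpos w ((hW w).1 w.2) (by simpa using hw)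
    let BW : LinearMap.BilinForm ℝ W :=
      LinearMap.BilinForm.restrict ((B : V →L[ℝ] V →L[ℝ] ℝ).toLinearMap₁₂) W
    have hBW : ∀ x y : W, BW x y = B (x : V) y := fun x y ↦ rfl
    have hsymmW : LinearMap.IsSymm BW := ⟨fun x y ↦ by rw [hBW, hBW]; exact hBsymm _ _⟩
    obtain ⟨b₀, hb₀⟩ := LinearMap.BilinForm.exists_orthogonal_basis hsymmW
    rw [LinearMap.isOrthoᵢ_def] at hb₀
    let b₁ : Module.Basis (Fin 3) ℝ W := b₀.reindex (finCongr hW3)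
    have hb₁ : ∀ i j, i ≠ j → B (b₁ i : V) (b₁ j) = 0 := by
      intro i j hij
      have h := hb₀ ((finCongr hW3).symm i) ((finCongr hW3).symm j)
        (fun h ↦ hij (by simpa using h))
      rw [← hBW]
      simpa [b₁] using h
    have hd : ∀ i, 0 < B (b₁ i : V) (b₁ i) := fun i ↦ hposW _ (b₁.ne_zero i)
    let u : Fin 3 → ℝˣ := fun i ↦
      Units.mk0 (Real.sqrt (B (b₁ i : V) (b₁ i)))⁻¹ (inv_ne_zero (Real.sqrt_pos.2 (hd i)).ne')
    let e : Module.Basis (Fin 3) ℝ W := b₁.unitsSMul u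
    have he_apply : ∀ i, (e i : V) = (Real.sqrt (B (b₁ i : V) (b₁ i)))⁻¹ • (b₁ i : V) := by
      intro i
      show ((b₁.unitsSMul u i : W) : V) = _
      rw [Module.Basis.unitsSMul_apply, Units.smul_def, Submodule.coe_smul]
      rfl
    have he : ∀ i j, B (e i : V) (e j) = if i = j then 1 else 0 := by
      intro i j
      rw [he_apply, he_apply]
      simp only [map_smul, smul_apply, smul_eq_mul]
      split_ifs with h
      · subst h
        rw [← mul_assoc, ← mul_inv, Real.mul_self_sqrt (hd i).le, inv_mul_cancel₀ (hd i).ne']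
      · rw [hb₁ i j h, mul_zero, mul_zero]
    have heW : ∀ i j, BW (e i) (e j) = if i = j then 1 else 0 := fun i j ↦ by rw [hBW, he]
    have hrepr : ∀ (w : W) i, e.repr w i = B (e i : V) w := fun w i ↦ by
      rw [basisRepr_eq_of_orthonormal e BW heW w i, hBW]
    -- the restricted operator and its (skew) matrix
    let AW : W →ₗ[ℝ] W := (A : V →ₗ[ℝ] V).restrict hAW
    have hAW_apply : ∀ w : W, (AW w : V) = A w := fun w ↦ rfl
    have hskew : ∀ i j, B (e i : V) (A (e j)) = -B (e j : V) (A (e i)) := by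
      intro i j
      have h := hA (e j : V) (e i)
      rw [hBsymm (A (e j : V)) (e i)] at h
      linarith
    have hdiag : ∀ i, B (e i : V) (A (e i)) = 0 := fun i ↦ by
      have h := hskew i i
      linarith
    set a := B (e 0 : V) (A (e 1)) with ha
    set b := B (e 0 : V) (A (e 2)) with hb
    set c := B (e 1 : V) (A (e 2)) with hc
    have hM : LinearMap.toMatrix e e AW = !![0, a, b; -a, 0, c; -b, -c, 0] := by
      ext i j
      rw [LinearMap.toMatrix_apply, hrepr, hAW_apply]
      fin_cases i <;> fin_cases j
      · exact hdiag 0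
      · rfl
      · rfl
      · exact hskew 1 0
      · exact hdiag 1
      · rfl
      · exact hskew 2 0
      · exact hskew 2 1
      · exact hdiag 2
    -- cube law on `W`, then on `V`
    have hcubeW : AW * AW * AW = -(a ^ 2 + b ^ 2 + c ^ 2) • AW := by
      apply (LinearMap.toMatrix e e).injective
      rw [LinearMap.toMatrix_mul, LinearMap.toMatrix_mul, map_smul, hM]
      exact skewMatrix_fin_three_mul_mul_self a b c
    have hAv : ∀ v, A v = A (⟨v - (B p v / B p p) • p, hdec v⟩ : W) := by
      intro v
      simp [map_sub, map_smul, hAp]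
    refine ⟨a ^ 2 + b ^ 2 + c ^ 2, by positivity, ?_, fun hs ↦ ?_⟩
    · ext v
      have h3 := congrArg (fun f : W →ₗ[ℝ] W ↦ ((f ⟨v - (B p v / B p p) • p, hdec v⟩ : W) : V))
        hcubeW
      simp only [Module.End.mul_apply, LinearMap.smul_apply, Submodule.coe_smul, hAW_apply] at h3
      show A (A (A v)) = (-(a ^ 2 + b ^ 2 + c ^ 2)) • A v
      rw [hAv v]
      exact h3
    · have ha0 : a = 0 := by nlinarith [sq_nonneg a, sq_nonneg b, sq_nonneg c]
      have hb0 : b = 0 := by nlinarith [sq_nonneg a, sq_nonneg b, sq_nonneg c]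
      have hc0 : c = 0 := by nlinarith [sq_nonneg a, sq_nonneg b, sq_nonneg c]
      have hAW0 : AW = 0 := by
        apply (LinearMap.toMatrix e e).injective
        rw [hM, map_zero, ha0, hb0, hc0]
        ext i j
        fin_cases i <;> fin_cases j <;> simp
      ext v
      rw [hAv v, ← hAW_apply, hAW0]
      simp
  -- conclusion from the cube law
  rcases hs0.eq_or_lt with hs | hs
  · refine ⟨1, one_ne_zero, ?_⟩
    rw [hzero hs.symm, smul_zero, NormedSpace.exp_zero]
  · have hκ : Real.sqrt s ≠ 0 := (Real.sqrt_pos.2 hs).ne'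
    refine ⟨2 * Real.pi / Real.sqrt s, by positivity, ?_⟩
    refine exp_smul_eq_one_of_mul_mul_self_eq A hκ ?_
    rw [Real.sq_sqrt hs.le]
    exact hcube

end RotationGenerator

/-- **Reduction of the Beig–Chruściel combination to an axis point in the stationary region.**
`BeigChrusciel1997_axisymmetricCombination` follows from: for every `𝓑`, `K` as there, some
combination `Y = a • T + b • K` with `b ≠ 0` vanishes at a point `x₀` at which the stationary
Killing field `T = 𝓑.killing` is timelike.  Indeed `A = ∇Y(x₀)` is `g_{x₀}`-skew (Killing
equation) and annihilates the timelike vector `T(x₀)`, because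
`∇_{T(x₀)} Y - ∇_{Y(x₀)} T = [T, Y](x₀) = 0` (torsion-freeness, `[T, a • T + b • K] = 0`) and
`Y(x₀) = 0`; so `A` is an infinitesimal rotation of the Euclidean `3`-space `T(x₀)^⊥` and
`exp(τ A) = 1` for some `τ ≠ 0` (`exists_exp_smul_eq_one_of_skew_of_apply_eq_zero`), which is
the hypothesis of `of_exp_axis`.  This is Beig–Chruściel's "`λ^μ_ν p^ν = 0`, so that `λ`
generates space-rotations" (§1), read at an axis point instead of at infinity; what remains of
Thm. 1.2 is the existence of such an axis point, the content of their asymptotic analysis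
(Props. 2.1–2.4). [cite: BeigChrusciel1997, §1 and proof of Thm. 1.2] -/
theorem BeigChrusciel1997_axisymmetricCombination.of_timelike_axis.{v}
    (h : ∀ (𝓑 : StationaryAFBlackHole.{v}) [𝓑.metric.HasLeviCivita],
      𝓑.IsIPlusRegularNonDegenerate → 𝓑.metric.toPseudoRiemannianMetric.IsRicciFlat →
      ∀ K : Π x : 𝓑.carrier, TangentSpace (𝓡 4) x,
        𝓑.metric.IsKillingField K → IsCompleteVectorField K →
        (∀ x, VectorField.mlieBracket (𝓡 4) 𝓑.killing K x = 0) →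
        (¬ ∃ c : ℝ, K = c • 𝓑.killing) →
        ∃ a b : ℝ, b ≠ 0 ∧ ∃ x₀, (a • 𝓑.killing + b • K) x₀ = 0 ∧
          𝓑.metric.val x₀ (𝓑.killing x₀) (𝓑.killing x₀) < 0) :
    BeigChrusciel1997_axisymmetricCombination.{v} := by
  refine BeigChrusciel1997_axisymmetricCombination.of_exp_axis
    fun 𝓑 _ hreg hvac K hK hKc hcomm hrot ↦ ?_
  obtain ⟨a, b, hb, x₀, hx₀, hT⟩ := h 𝓑 hreg hvac K hK hKc hcomm hrot
  have hY : 𝓑.metric.IsKillingField (a • 𝓑.killing + b • K) :=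
    𝓑.isStationaryKilling.isKillingField.linearCombination hK a b
  have hLC : 𝓑.metric.IsLeviCivita 𝓑.metric.leviCivita :=
    PseudoRiemannianMetric.isLeviCivita_leviCivita_holds
  -- `∇_{T(x₀)} Y = [T, Y](x₀) + ∇_{Y(x₀)} T = 0`
  have hAT : 𝓑.metric.leviCivita (a • 𝓑.killing + b • K) x₀ (𝓑.killing x₀) = 0 := by
    have htor := (𝓑.metric.leviCivita.torsion_eq_zero_iff).1 hLC.1
      (𝓑.isStationaryKilling.isKillingField.mdifferentiableAt x₀) (hY.mdifferentiableAt x₀)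
    rw [𝓑.mlieBracket_killing_linearCombination hK hcomm a b x₀, hx₀, map_zero, sub_zero] at htor
    exact htor
  obtain ⟨τ, hτ, hexp⟩ := exists_exp_smul_eq_one_of_skew_of_apply_eq_zero
    (V := EuclideanSpace ℝ (Fin 4)) (by simp) (𝓑.metric.val x₀) (𝓑.metric.symm x₀) hT
    (fun w hw hw0 ↦ 𝓑.metric.pos_of_orthogonal x₀ _ w hT hw hw0)
    (𝓑.metric.leviCivita (a • 𝓑.killing + b • K) x₀) (hY.val_leviCivita_add x₀) hAT
  exact ⟨a, b, τ, hb, hτ, x₀, hx₀, hexp⟩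

/-- **Reduction to "the axis meets `M_ext`".** `BeigChrusciel1997_axisymmetricCombination` follows
from: for every `𝓑`, `K` as there, some combination `a • T + b • K` with `b ≠ 0` vanishes at a
point of the asymptotic region `M_ext = ⋃ₜ φₜ(Σ_ext)` (where the stationary field is timelike,
`IsStationaryKilling.isTimelike`); by `of_timelike_axis`.  This is the form in which Beig–Chruściel's
asymptotic analysis delivers the rotational Killing field: its axis `{X = 0}` is a timelike
surface extending into the asymptotically flat end (Props. 2.2–2.4 and the proof of Thm. 1.2,
case (ii), "`X₂ + αX₁` has the required asymptotic behaviour — a rotation").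
[cite: BeigChrusciel1997, Props. 2.2–2.4 and proof of Thm. 1.2] -/
theorem BeigChrusciel1997_axisymmetricCombination.of_axis_mem_Mext.{v}
    (h : ∀ (𝓑 : StationaryAFBlackHole.{v}) [𝓑.metric.HasLeviCivita],
      𝓑.IsIPlusRegularNonDegenerate → 𝓑.metric.toPseudoRiemannianMetric.IsRicciFlat →
      ∀ K : Π x : 𝓑.carrier, TangentSpace (𝓡 4) x,
        𝓑.metric.IsKillingField K → IsCompleteVectorField K →
        (∀ x, VectorField.mlieBracket (𝓡 4) 𝓑.killing K x = 0) →
        (¬ ∃ c : ℝ, K = c • 𝓑.killing) →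
        ∃ a b : ℝ, b ≠ 0 ∧ ∃ x₀ ∈ 𝓑.Mext, (a • 𝓑.killing + b • K) x₀ = 0) :
    BeigChrusciel1997_axisymmetricCombination.{v} :=
  BeigChrusciel1997_axisymmetricCombination.of_timelike_axis
    fun 𝓑 _ hreg hvac K hK hKc hcomm hrot ↦ by
      obtain ⟨a, b, hb, x₀, hx₀M, hx₀⟩ := h 𝓑 hreg hvac K hK hKc hcomm hrot
      exact ⟨a, b, hb, x₀, hx₀, (𝓑.isStationaryKilling.isTimelike hx₀M).1⟩

/-- **The remaining obligation in its simplest form: `K` is parallel to `T` somewhere in `M_ext`.**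
`BeigChrusciel1997_axisymmetricCombination` follows from: for every `𝓑`, `K` as there, at some
point `x₀` of the asymptotic region `M_ext` the field `K` is a multiple of the stationary field,
`K(x₀) = c • T(x₀)` (then `Y = -c • T + K` has the axis point `x₀ ∈ M_ext`, `of_axis_mem_Mext`
with `b = 1`).  Equivalently: the `2`-planes `span{T, K}` degenerate somewhere in `M_ext` — for a
rotational `K` this happens exactly on its axis.  This is what Beig–Chruściel's asymptotic
analysis establishes (Props. 2.1–2.4 with Thm. 1.1); everything downstream is proved above.
[cite: BeigChrusciel1997, Props. 2.2–2.4 and proof of Thm. 1.2] -/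
theorem BeigChrusciel1997_axisymmetricCombination.of_parallel_mem_Mext.{v}
    (h : ∀ (𝓑 : StationaryAFBlackHole.{v}) [𝓑.metric.HasLeviCivita],
      𝓑.IsIPlusRegularNonDegenerate → 𝓑.metric.toPseudoRiemannianMetric.IsRicciFlat →
      ∀ K : Π x : 𝓑.carrier, TangentSpace (𝓡 4) x,
        𝓑.metric.IsKillingField K → IsCompleteVectorField K →
        (∀ x, VectorField.mlieBracket (𝓡 4) 𝓑.killing K x = 0) →
        (¬ ∃ c : ℝ, K = c • 𝓑.killing) →
        ∃ c : ℝ, ∃ x₀ ∈ 𝓑.Mext, K x₀ = c • 𝓑.killing x₀) :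
    BeigChrusciel1997_axisymmetricCombination.{v} :=
  BeigChrusciel1997_axisymmetricCombination.of_axis_mem_Mext
    fun 𝓑 _ hreg hvac K hK hKc hcomm hrot ↦ by
      obtain ⟨c, x₀, hx₀M, hx₀⟩ := h 𝓑 hreg hvac K hK hKc hcomm hrot
      refine ⟨-c, 1, one_ne_zero, x₀, hx₀M, ?_⟩
      simp only [Pi.add_apply, Pi.smul_apply, Pi.neg_apply, hx₀, one_smul, neg_smul,
        neg_add_cancel]

/-- Conversely, the conclusion of `BeigChrusciel1997_axisymmetricCombination` trivially gives a
point (the axis point, a priori anywhere in space-time) at which `K` is parallel to `T`; the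
content of the remaining obligation `of_parallel_mem_Mext` is thus the *location* of such a point
in the asymptotic region. [cite: BeigChrusciel1997, Thm. 1.2] -/
theorem BeigChrusciel1997_axisymmetricCombination.exists_apply_eq_smul.{v}
    (h : BeigChrusciel1997_axisymmetricCombination.{v}) (𝓑 : StationaryAFBlackHole.{v})
    [𝓑.metric.HasLeviCivita] (hreg : 𝓑.IsIPlusRegularNonDegenerate)
    (hvac : 𝓑.metric.toPseudoRiemannianMetric.IsRicciFlat)
    {K : Π x : 𝓑.carrier, TangentSpace (𝓡 4) x} (hK : 𝓑.metric.IsKillingField K)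
    (hKc : IsCompleteVectorField K) (hcomm : ∀ x, VectorField.mlieBracket (𝓡 4) 𝓑.killing K x = 0)
    (hrot : ¬ ∃ c : ℝ, K = c • 𝓑.killing) :
    ∃ c : ℝ, ∃ x₀, K x₀ = c • 𝓑.killing x₀ := by
  obtain ⟨a, b, hb, -, -, x₀, hx₀⟩ := h 𝓑 hreg hvac K hK hKc hcomm hrot
  refine ⟨-(a / b), x₀, ?_⟩
  have h0 : a • 𝓑.killing x₀ + b • K x₀ = 0 := hx₀
  have h1 : K x₀ = b⁻¹ • (b • K x₀) := by rw [smul_smul, inv_mul_cancel₀ hb, one_smul]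
  rw [h1, eq_neg_of_add_eq_zero_right h0, smul_neg, smul_smul, neg_smul, div_eq_inv_mul]

end Literature.Geometry.Lorentzian

end
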